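import Literature.Barriers.FinalStateConjecture.ExtremalHorizonInstabilityAssembly
import HarnessLib

/-!
# Barrier catalogue `FinalStateConjecture`: the second-order horizon identity on extremal Kerr
# (the mechanism of Aretakis's Theorem 2) and sphere lemmas with source terms
# (`Literature/Barriers/FinalStateConjecture/`, D-0021, D-0014; family `gr`)

`ExtremalHorizonAxisymmetricDecay.lean` vendors the `k = 2` clause of Aretakis's Theorem 3 (ATMP 19
(2015)) for axisymmetric solutions as the named fact `Aretakis2015_axisymmetricBlowup`, whose printed
proof is the sentence "Combining the methods of [aretakis2], the results of the present paper … and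
[aretakis3]". The mechanism is that of Theorem 2 of the same paper (printed with proof, for general
extremal horizons): restrict `Y(√g □_g ψ) = 0` to the horizon and integrate over the sections `S_τ`;
the only terms without a `V`- or `Φ`-derivative are `√g · YY(g^{YY}) · Yψ` and a `Θ`-total derivative,
so that `∫_{S_τ} f[ψ, Dψ, DDψ]` changes at the rate `−c ∫_{S_τ} Yψ`, which tends to the conserved
charge. This file **proves the corresponding pointwise identity on the extremal Kerr horizon** and the
integration lemmas needed to run the mechanism; the blow-up itself (the discharge of
`Aretakis2015_axisymmetricBlowup` from the decay fact `Aretakis2012_pointwiseDecay`) is the object of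
`ExtremalHorizonBlowupProofs.lean`.

* **Derivatives along the null lines** (general Kerr–Schild, any `M, a`, `r > 0`): `∂_{ℓ♯} Σ = 2r`,
  `∂_{ℓ♯} g^{μν} = −2 (∂_{ℓ♯}H) ℓ^ν ℓ^μ`, `∂_{ℓ♯} c^ν = (4Mr/Σ²) ℓ^ν` for `c^ν = ∑_μ ∂_μ g^{μν} = −(2M/Σ)ℓ^ν`
  (`fderiv_blSigma_spatial_nullVector`, `fderiv_inverseMetric_nullVector`,
  `fderiv_divInverseMetric_nullVector`), and their values on the extremal horizon
  (`Σ² ∂_{ℓ♯} g^{μν} = 2M³ sin² θ ℓ^ν ℓ^μ`, `Σ² ∂_{ℓ♯} c^ν = 4M² ℓ^ν`).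
* **The second-order horizon identity** (`horizon_secondOrder_identity`): at a horizon point
  `p = p_σ(θ, φ)`, for a totally symmetric trilinear `C`, a symmetric bilinear `B` and a linear `L`
  (third and second derivatives and differential of `Ψ` at `p`),
  `sin θ {M² sin² θ C(T,T,Y) + 4M² C(T,Y,Y) + 6M B(T,Y) + 2L(T) + 2L(Y)} + ∂_φ E₂ + ∂_θ T₂
    = sin θ (2M W₁ + Σ W₂)`,
  where `W₁` is the coordinate wave expression `∑ g^{μν} B(∂_μ,∂_ν) + ∑ c^ν L(∂_ν)` at `p`, `W₂` its
  derivative along `ℓ♯ = Y`, and `E₂ = 2M sin θ (B(T,Y) + B(Y,Y)) + B(Φ̂,Y) + L(n̂)`,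
  `T₂ = sin θ (B(Θ,Y) + L(∂_θ Y))` are tangential fluxes (`n̂ = ∂_φ Y / sin θ`). In Aretakis's
  coordinates `(v, r, θ, φ*)` (§5.2) this is `sin θ · Y(ρ² □_g ψ)` at `r = M`:
  `Y(ρ² □_g ψ)|_{𝓗⁺} = M² sin² θ TTYψ + 4M² TYYψ + 6M TYψ + 2Tψ + 2Yψ + 2M ΦY(Tψ + Yψ) + ∆_{S²} Yψ`
  (from `ρ² □_g ψ = M² sin² θ TTψ + 2(r² + M²) TYψ + Δ YYψ + 2M TΦψ + 2M YΦψ + 2r Tψ + Δ' Yψ + ∆_{S²}ψ`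
  by differentiating the coefficients `2(r² + M²)`, `2r`, `Δ'` in `r`; the display before Prop. 5.1
  prints the `TYψ` coefficient as `2M` and an `M`-inconsistent `H₁`, immaterial there and corrected
  here by the library's metric). The proof splits into the third-order part (total symmetry only,
  `secondOrder_alg_C`), the first/second-order part (a polynomial identity in the components,
  `secondOrder_alg_BL`) and the metric input (`Σ ∑ g^{μν} B(∂_μ,∂_ν)` on the horizon,
  `Kerr.blSigma_mul_sum_inverseMetric_horizon`, `c^ν`, and the two null-line derivatives above).
* **The second-order density** `D₂ = (M² sin² θ TYΨ + 4M² YYΨ + 6M YΨ + 2Ψ)(p_σ(θ,φ)) · 2M² sin θ`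
  (`secondDensity`) with its fluxes (`secondPhiFlux`, `secondThetaFlux`), their derivatives
  (`hasDerivAt_secondDensity_sigma`, `hasDerivAt_secondPhiFlux_phi`, `hasDerivAt_secondThetaFlux_theta`)
  and joint continuity, for a smooth `Ψ : E4 → ℝ`; for a solution (`W₁ = W₂ = 0` at `p`)
  `∂_σ D₂ = −2M² (∂_φ E₂ + ∂_θ T₂) − 4M² sin θ · YΨ` (`hasDerivAt_secondDensity_of_wave`): the
  `T`-antiderivative of the identity, i.e. Aretakis's `∫∫ V(f[ψ,Dψ,DDψ]) + ∫∫ Yψ = 0` before integration.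
* **Sphere lemmas**: conservation with a source term on `[a, b] ⊆ [0, ∞)`
  (`sphereIntegral_eq_add_source`: `∫∫ D(b) = ∫∫ D(a) + ∫_a^b ∫∫ S`) and the static integration of
  tangential total derivatives (`sphereIntegral_eq_of_fluxes`: `∫∫ (c(∂_φ E + ∂_θ T) + g) = ∫∫ g`),
  by the fundamental theorem of calculus and Fubini for continuous integrands, as in
  `Kerr.sphereIntegral_eq_of_hasDerivAt` (`ExtremalHorizonChargeConservationProofs.lean`).

Only real analysis from Mathlib is used (chain rule for operator-valued maps, symmetry of second and
third derivatives, FTC, Fubini on rectangles, continuity of parametric interval integrals).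

## References

* S. Aretakis, *Horizon instability of extremal black holes*, Adv. Theor. Math. Phys. 19 (2015)
  507–530 (arXiv:1206.6598): Thm. 2 (Blow-up) and its proof (p. 10), §5.2 (the metric, `□_g` in
  `(v, r, θ, φ*)`, "by restricting `Y(ρ² □_g ψ) = 0` on `𝓗`", p. 12) (key `Aretakis2015`).
* R. P. Kerr, A. Schild, 1965, §2 (key `KerrSchild1965`); M. Visser, arXiv:0706.0622, (33)–(35)
  (key `arXiv07060622`).
-/

noncomputable section

open Set Filter MeasureTheory intervalIntegral
open scoped Topology ContDiff Manifold

namespace Literature.Barriers.FinalStateConjecture.Kerr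

open Literature.Geometry.Lorentzian

/-! ### Derivatives of `Σ`, `g^{μν}` and `c^ν` along the null lines -/

/-- **`∂_{ℓ♯} Σ = 2r`** (along the null lines `Σ(x + sℓ♯) = Σ(x) + 2rs + s²`).
[cite: KerrSchild1965, §2] -/
theorem fderiv_blSigma_spatial_nullVector {a : ℝ} {x : E4} (hx : 0 < Kerr.radius a x) :
    fderiv ℝ (fun y ↦ Kerr.blSigma a (E4.spatial y)) x (Kerr.nullVector a x) =
      2 * Kerr.radius a x := by
  have hd : DifferentiableAt ℝ (fun y ↦ Kerr.blSigma a (E4.spatial y)) x := by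
    have hfun : (fun y ↦ Kerr.blSigma a (E4.spatial y)) =
        fun y ↦ 2 * Kerr.radius a y ^ 2 - E4.spatialNorm y ^ 2 + a ^ 2 :=
      funext fun y ↦ Kerr.blSigma_spatial_eq a y
    rw [hfun]
    exact ((((contDiffAt_const (c := (2 : ℝ))).mul ((Kerr.contDiffAt_radius hx (n := 1)).pow 2)).sub
      Kerr.contDiff_spatialNorm_sq.contDiffAt).add contDiffAt_const).differentiableAt one_ne_zero
  have h1 : HasLineDerivAt ℝ (fun y ↦ Kerr.blSigma a (E4.spatial y))
      (fderiv ℝ (fun y ↦ Kerr.blSigma a (E4.spatial y)) x (Kerr.nullVector a x)) x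
      (Kerr.nullVector a x) := hd.hasFDerivAt.hasLineDerivAt _
  have h2 : HasLineDerivAt ℝ (fun y ↦ Kerr.blSigma a (E4.spatial y)) (2 * Kerr.radius a x) x
      (Kerr.nullVector a x) := by
    have hev : (fun s : ℝ ↦ Kerr.blSigma a (E4.spatial (x + s • Kerr.nullVector a x))) =ᶠ[𝓝 0]
        fun s ↦ Kerr.blSigma a (E4.spatial x) + 2 * Kerr.radius a x * s + s ^ 2 := by
      filter_upwards [Kerr.eventually_radius_add_pos hx] with s hs
      exact Kerr.blSigma_spatial_add_smul_nullVector hx hs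
    show HasDerivAt (fun s : ℝ ↦ Kerr.blSigma a (E4.spatial (x + s • Kerr.nullVector a x))) _ 0
    have h : HasDerivAt (fun s : ℝ ↦ Kerr.blSigma a (E4.spatial x) + 2 * Kerr.radius a x * s + s ^ 2)
        (2 * Kerr.radius a x) 0 := by
      have h1 : HasDerivAt (fun s : ℝ ↦ Kerr.blSigma a (E4.spatial x) + 2 * Kerr.radius a x * s)
          (2 * Kerr.radius a x) 0 := by
        simpa using ((hasDerivAt_id (0 : ℝ)).const_mul (2 * Kerr.radius a x)).const_add
          (Kerr.blSigma a (E4.spatial x))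
      have h2 : HasDerivAt (fun s : ℝ ↦ s ^ 2) 0 0 := by simpa using hasDerivAt_pow 2 (0 : ℝ)
      have h := h1.add h2
      rw [add_zero] at h
      exact h.congr_of_eventuallyEq (Eventually.of_forall fun s ↦ rfl)
    exact h.congr_of_eventuallyEq hev
  exact h1.unique h2

/-- **`∂_{ℓ♯} g^{μν} = −2 (∂_{ℓ♯} H) ℓ^ν ℓ^μ`** with `∂_{ℓ♯} H = M(Σ − 2r²)/Σ²` (geodesy `∂_{ℓ♯} ℓ^μ = 0`).
[cite: KerrSchild1965, §2] -/
theorem fderiv_inverseMetric_nullVector (M : ℝ) {a : ℝ} {x : E4} (hx : 0 < Kerr.radius a x)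
    (μ ν : Fin 4) :
    fderiv ℝ (fun y ↦ Kerr.inverseMetric M a y μ ν) x (Kerr.nullVector a x) =
      -(2 * (M * (Kerr.blSigma a (E4.spatial x) - 2 * Kerr.radius a x ^ 2) /
          Kerr.blSigma a (E4.spatial x) ^ 2)) * Kerr.nullVector a x ν * Kerr.nullVector a x μ := by
  have hfun : (fun y ↦ Kerr.inverseMetric M a y μ ν) =
      fun y ↦ Kerr.etaComp μ ν - ((fun y ↦ 2 * Kerr.scalarH M a y) * (fun y ↦ Kerr.nullVector a y ν) *
        (fun y ↦ Kerr.nullVector a y μ)) y := by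
    funext y; rw [Kerr.inverseMetric_apply]; simp only [Pi.mul_apply]; rfl
  have hH : HasFDerivAt (Kerr.scalarH M a) (fderiv ℝ (Kerr.scalarH M a) x) x :=
    ((Kerr.contDiffAt_scalarH M a hx (n := 1)).differentiableAt one_ne_zero).hasFDerivAt
  have hVd : ∀ κ, HasFDerivAt (fun y ↦ Kerr.nullVector a y κ)
      (fderiv ℝ (fun y ↦ Kerr.nullVector a y κ) x) x := fun κ ↦
    ((contDiffAt_euclidean.mp (Kerr.contDiffAt_nullVector a hx (n := 1)) κ).differentiableAt
      one_ne_zero).hasFDerivAt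
  rw [hfun, ((((hH.const_mul 2).mul (hVd ν)).mul (hVd μ)).const_sub (Kerr.etaComp μ ν)).fderiv]
  simp [Pi.mul_apply, smul_eq_mul, Kerr.fderiv_nullVector_apply_nullVector hx,
    Kerr.fderiv_scalarH_nullVector M hx]
  ring

/-- **`∂_{ℓ♯} c^ν = (4Mr/Σ²) ℓ^ν`** for `c^ν = −(2M/Σ) ℓ^ν` (`∂_{ℓ♯} Σ = 2r`, `∂_{ℓ♯} ℓ^ν = 0`).
[cite: KerrSchild1965, §2] -/
theorem fderiv_divInverseMetric_nullVector (M : ℝ) {a : ℝ} {x : E4} (hx : 0 < Kerr.radius a x)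
    (ν : Fin 4) :
    fderiv ℝ (fun y ↦ Kerr.divInverseMetric M a y ν) x (Kerr.nullVector a x) =
      4 * M * Kerr.radius a x / Kerr.blSigma a (E4.spatial x) ^ 2 * Kerr.nullVector a x ν := by
  have hSig := Kerr.blSigma_spatial_pos hx
  have hd : DifferentiableAt ℝ (fun y ↦ Kerr.divInverseMetric M a y ν) x :=
    (contDiffAt_divInverseMetric M a hx ν (n := 1)).differentiableAt one_ne_zero
  have h1 : HasLineDerivAt ℝ (fun y ↦ Kerr.divInverseMetric M a y ν)
      (fderiv ℝ (fun y ↦ Kerr.divInverseMetric M a y ν) x (Kerr.nullVector a x)) x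
      (Kerr.nullVector a x) := hd.hasFDerivAt.hasLineDerivAt _
  have h2 : HasLineDerivAt ℝ (fun y ↦ Kerr.divInverseMetric M a y ν)
      (4 * M * Kerr.radius a x / Kerr.blSigma a (E4.spatial x) ^ 2 * Kerr.nullVector a x ν) x
      (Kerr.nullVector a x) := by
    have hev : (fun s : ℝ ↦ Kerr.divInverseMetric M a (x + s • Kerr.nullVector a x) ν) =ᶠ[𝓝 0]
        fun s ↦ -(2 * M / (Kerr.blSigma a (E4.spatial x) + 2 * Kerr.radius a x * s + s ^ 2)) *
          Kerr.nullVector a x ν := by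
      filter_upwards [Kerr.eventually_radius_add_pos hx] with s hs
      have hxs : 0 < Kerr.radius a (x + s • Kerr.nullVector a x) := by
        rwa [Kerr.radius_add_smul_nullVector hx hs]
      rw [Kerr.divInverseMetric_eq M a hxs, Kerr.blSigma_spatial_add_smul_nullVector hx hs,
        Kerr.nullVector_add_smul_nullVector hx hs]
    show HasDerivAt (fun s : ℝ ↦ Kerr.divInverseMetric M a (x + s • Kerr.nullVector a x) ν) _ 0
    have hden : HasDerivAt (fun s : ℝ ↦ Kerr.blSigma a (E4.spatial x) + 2 * Kerr.radius a x * s + s ^ 2)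
        (2 * Kerr.radius a x) 0 := by
      have h1 : HasDerivAt (fun s : ℝ ↦ Kerr.blSigma a (E4.spatial x) + 2 * Kerr.radius a x * s)
          (2 * Kerr.radius a x) 0 := by
        simpa using ((hasDerivAt_id (0 : ℝ)).const_mul (2 * Kerr.radius a x)).const_add
          (Kerr.blSigma a (E4.spatial x))
      have h2 : HasDerivAt (fun s : ℝ ↦ s ^ 2) 0 0 := by simpa using hasDerivAt_pow 2 (0 : ℝ)
      have h := h1.add h2
      rw [add_zero] at h
      exact h.congr_of_eventuallyEq (Eventually.of_forall fun s ↦ rfl)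
    have hc : HasDerivAt (fun _ : ℝ ↦ (2 * M : ℝ)) 0 0 := hasDerivAt_const 0 _
    have hdiv := ((hc.div hden (by simpa using hSig.ne')).neg).mul_const (Kerr.nullVector a x ν)
    have hq : HasDerivAt (fun s : ℝ ↦ -(2 * M / (Kerr.blSigma a (E4.spatial x) + 2 * Kerr.radius a x * s + s ^ 2)) *
        Kerr.nullVector a x ν) (4 * M * Kerr.radius a x / Kerr.blSigma a (E4.spatial x) ^ 2 * Kerr.nullVector a x ν) 0 := by
      refine (hdiv.congr_of_eventuallyEq (Eventually.of_forall fun s ↦ ?_)).congr_deriv ?_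
      · simp only [Pi.neg_apply, Pi.div_apply]
      · have hS0 : Kerr.blSigma a (E4.spatial x) ≠ 0 := hSig.ne'
        field_simp
        ring
    exact hq.congr_of_eventuallyEq hev
  exact h1.unique h2

/-! ### The same derivatives at the horizon points -/

/-- On the horizon `Σ² ∂_{ℓ♯} g^{μν} = 2M³ sin² θ · ℓ^ν ℓ^μ` (`Σ − 2r² = −M² sin² θ` at `r = M`).
[cite: Aretakis2015, §5.2] -/
theorem blSigma_sq_mul_fderiv_inverseMetric_horizon {M : ℝ} (hM : 0 < M) (σ θ φ : ℝ) (μ ν : Fin 4) :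
    Kerr.blSigma M (E4.spatial (horizonPoint M σ θ φ)) ^ 2 *
        fderiv ℝ (fun y ↦ Kerr.inverseMetric M M y μ ν) (horizonPoint M σ θ φ)
          (Kerr.nullVector M (horizonPoint M σ θ φ)) =
      2 * M ^ 3 * Real.sin θ ^ 2 * horizonNull θ φ ν * horizonNull θ φ μ := by
  have hr := radius_horizonPoint hM.le σ θ φ
  have hpos : 0 < Kerr.radius M (horizonPoint M σ θ φ) := by rw [hr]; exact hM
  have hS := blSigma_horizonPoint hM.le σ θ φ
  have hSpos := Kerr.blSigma_spatial_pos hpos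
  rw [fderiv_inverseMetric_nullVector M hpos, nullVector_horizonPoint hM, hr]
  field_simp
  rw [hS]
  ring

/-- On the horizon `Σ² ∂_{ℓ♯} c^ν = 4M² ℓ^ν`. [cite: Aretakis2015, §5.2] -/
theorem blSigma_sq_mul_fderiv_divInverseMetric_horizon {M : ℝ} (hM : 0 < M) (σ θ φ : ℝ) (ν : Fin 4) :
    Kerr.blSigma M (E4.spatial (horizonPoint M σ θ φ)) ^ 2 *
        fderiv ℝ (fun y ↦ Kerr.divInverseMetric M M y ν) (horizonPoint M σ θ φ)
          (Kerr.nullVector M (horizonPoint M σ θ φ)) =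
      4 * M ^ 2 * horizonNull θ φ ν := by
  have hr := radius_horizonPoint hM.le σ θ φ
  have hpos : 0 < Kerr.radius M (horizonPoint M σ θ φ) := by rw [hr]; exact hM
  have hSpos := Kerr.blSigma_spatial_pos hpos
  rw [fderiv_divInverseMetric_nullVector M hpos, nullVector_horizonPoint hM, hr]
  field_simp

/-! ### Further frame vectors along the horizon spheres and their derivatives -/

/-- `∂_θ ℓ♯` along the horizon spheres. [folklore] -/
def dThetaHorizonNull (θ φ : ℝ) : E4 :=
  WithLp.toLp 2 ![0, Real.cos θ * Real.cos φ, Real.cos θ * Real.sin φ, -Real.sin θ]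

/-- The unit azimuthal direction `n̂ = ∂_φ ℓ♯ / sin θ = (0, −sin φ, cos φ, 0)`. [folklore] -/
def unitPhiVec (φ : ℝ) : E4 :=
  WithLp.toLp 2 ![0, -Real.sin φ, Real.cos φ, 0]

/-- `∂_φ n̂`. [folklore] -/
def dUnitPhiVec (φ : ℝ) : E4 :=
  WithLp.toLp 2 ![0, -Real.cos φ, -Real.sin φ, 0]

/-- `∂_θ ℓ♯ = dThetaHorizonNull`. [folklore] -/
theorem hasDerivAt_horizonNull_theta (θ φ : ℝ) :
    HasDerivAt (fun θ' ↦ horizonNull θ' φ) (dThetaHorizonNull θ φ) θ := by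
  refine (hasDerivAt_toLp_four (hasDerivAt_const θ (-1 : ℝ))
    ((Real.hasDerivAt_sin θ).mul_const (Real.cos φ))
    ((Real.hasDerivAt_sin θ).mul_const (Real.sin φ))
    (Real.hasDerivAt_cos θ)).congr_deriv (toLp_four_eq rfl rfl rfl rfl)

/-- `∂_θ ∂_θ ℓ♯ = −(ℓ♯ + ∂_{t*})`. [folklore] -/
theorem hasDerivAt_dThetaHorizonNull_theta (θ φ : ℝ) :
    HasDerivAt (fun θ' ↦ dThetaHorizonNull θ' φ) (-(horizonNull θ φ + E4.basisVector 0)) θ := by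
  have hvec : -(horizonNull θ φ + E4.basisVector 0) = WithLp.toLp 2 ![0,
      -(Real.sin θ * Real.cos φ), -(Real.sin θ * Real.sin φ), -Real.cos θ] := by
    ext i
    fin_cases i <;> simp [horizonNull]
  rw [hvec]
  refine (hasDerivAt_toLp_four (hasDerivAt_const θ (0 : ℝ))
    ((Real.hasDerivAt_cos θ).mul_const (Real.cos φ))
    ((Real.hasDerivAt_cos θ).mul_const (Real.sin φ))
    (Real.hasDerivAt_sin θ).neg).congr_deriv (toLp_four_eq rfl ?_ ?_ rfl) <;> ring

/-- `∂_φ n̂ = dUnitPhiVec`. [folklore] -/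
theorem hasDerivAt_unitPhiVec (φ : ℝ) :
    HasDerivAt (fun φ' ↦ unitPhiVec φ') (dUnitPhiVec φ) φ := by
  refine (hasDerivAt_toLp_four (hasDerivAt_const φ (0 : ℝ))
    (Real.hasDerivAt_sin φ).neg (Real.hasDerivAt_cos φ)
    (hasDerivAt_const φ (0 : ℝ))).congr_deriv (toLp_four_eq rfl rfl rfl rfl)

/-- `∂_φ ℓ♯ = sin θ · n̂`. [folklore] -/
theorem dPhiHorizonNull_eq_smul (θ φ : ℝ) : dPhiHorizonNull θ φ = Real.sin θ • unitPhiVec φ := by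
  ext i
  fin_cases i <;> simp [dPhiHorizonNull, unitPhiVec]

/-! ### Expansions in the coordinate basis -/

/-- Expansion of a linear form in the coordinate basis: `L(v) = ∑ v^μ L(∂_μ)`. [folklore] -/
theorem lin_eq_sum (L : E4 →L[ℝ] ℝ) (v : E4) : L v = ∑ μ, v μ * L (E4.basisVector μ) := by
  conv_lhs => rw [Kerr.eq_sum_basisVector v, map_sum]
  exact Finset.sum_congr rfl fun μ _ ↦ by rw [map_smul, smul_eq_mul]

/-! ### The second-order horizon identity: algebraic parts -/

/-- The `C`-part of the second-order identity: under total symmetry the third-order terms of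
`sin θ · Y(ρ² □ ψ)` on the horizon are `sin θ · Σ ∑ g^{μν} C(Y, ∂_μ, ∂_ν)` in the adapted frame.
[cite: Aretakis2015, §5.2] -/
theorem secondOrder_alg_C (M θ φ : ℝ) (C : E4 →L[ℝ] E4 →L[ℝ] E4 →L[ℝ] ℝ)
    (hC₁ : ∀ u v w, C u v w = C v u w) (hC₂ : ∀ u v w, C u v w = C u w v) :
    Real.sin θ * (M ^ 2 * Real.sin θ ^ 2 * C (E4.basisVector 0) (E4.basisVector 0) (horizonNull θ φ) +
        4 * M ^ 2 * C (E4.basisVector 0) (horizonNull θ φ) (horizonNull θ φ)) +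
      (2 * M * Real.sin θ * (Real.sin θ * C (phiHatVec M φ) (E4.basisVector 0) (horizonNull θ φ) +
          Real.sin θ * C (phiHatVec M φ) (horizonNull θ φ) (horizonNull θ φ)) +
        Real.sin θ * C (phiHatVec M φ) (phiHatVec M φ) (horizonNull θ φ)) +
      Real.sin θ * C (thetaVec M θ φ) (thetaVec M θ φ) (horizonNull θ φ) =
    Real.sin θ *
      (M ^ 2 * Real.sin θ ^ 2 * C (horizonNull θ φ) (E4.basisVector 0) (E4.basisVector 0) +
        2 * M ^ 2 * (C (horizonNull θ φ) (E4.basisVector 0) (horizonNull θ φ) +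
          C (horizonNull θ φ) (horizonNull θ φ) (E4.basisVector 0)) +
        M * Real.sin θ * (C (horizonNull θ φ) (E4.basisVector 0) (phiHatVec M φ) +
          C (horizonNull θ φ) (phiHatVec M φ) (E4.basisVector 0)) +
        M * Real.sin θ * (C (horizonNull θ φ) (horizonNull θ φ) (phiHatVec M φ) +
          C (horizonNull θ φ) (phiHatVec M φ) (horizonNull θ φ)) +
        C (horizonNull θ φ) (thetaVec M θ φ) (thetaVec M θ φ) +
        C (horizonNull θ φ) (phiHatVec M φ) (phiHatVec M φ)) := by
  have c1 : C (E4.basisVector 0) (E4.basisVector 0) (horizonNull θ φ) =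
      C (horizonNull θ φ) (E4.basisVector 0) (E4.basisVector 0) := by rw [hC₂ (E4.basisVector 0), hC₁]
  have c2 : C (E4.basisVector 0) (horizonNull θ φ) (horizonNull θ φ) =
      C (horizonNull θ φ) (E4.basisVector 0) (horizonNull θ φ) := hC₁ _ _ _
  have c3 : C (phiHatVec M φ) (E4.basisVector 0) (horizonNull θ φ) =
      C (horizonNull θ φ) (E4.basisVector 0) (phiHatVec M φ) := by
    rw [hC₁ (phiHatVec M φ), hC₂ (E4.basisVector 0), hC₁ (E4.basisVector 0)]
  have c4 : C (phiHatVec M φ) (horizonNull θ φ) (horizonNull θ φ) =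
      C (horizonNull θ φ) (horizonNull θ φ) (phiHatVec M φ) := by
    rw [hC₁ (phiHatVec M φ), hC₂ (horizonNull θ φ)]
  have c5 : C (phiHatVec M φ) (phiHatVec M φ) (horizonNull θ φ) =
      C (horizonNull θ φ) (phiHatVec M φ) (phiHatVec M φ) := by
    rw [hC₂ (phiHatVec M φ), hC₁ (phiHatVec M φ)]
  have c6 : C (thetaVec M θ φ) (thetaVec M θ φ) (horizonNull θ φ) =
      C (horizonNull θ φ) (thetaVec M θ φ) (thetaVec M θ φ) := by
    rw [hC₂ (thetaVec M θ φ), hC₁ (thetaVec M θ φ)]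
  have r1 : C (horizonNull θ φ) (horizonNull θ φ) (E4.basisVector 0) =
      C (horizonNull θ φ) (E4.basisVector 0) (horizonNull θ φ) := hC₂ _ _ _
  have r2 : C (horizonNull θ φ) (phiHatVec M φ) (E4.basisVector 0) =
      C (horizonNull θ φ) (E4.basisVector 0) (phiHatVec M φ) := hC₂ _ _ _
  have r3 : C (horizonNull θ φ) (phiHatVec M φ) (horizonNull θ φ) =
      C (horizonNull θ φ) (horizonNull θ φ) (phiHatVec M φ) := hC₂ _ _ _
  rw [c1, c2, c3, c4, c5, c6, r1, r2, r3]
  ring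

/-- The `B, L`-part of the second-order identity (first- and second-order terms), a polynomial
identity in the components after clearing `Σ = M²(2 − sin² θ)`. [cite: Aretakis2015, §5.2] -/
theorem secondOrder_alg_BL (θ φ : ℝ) {M : ℝ} (hM : M ≠ 0) (h2s : (2 : ℝ) - Real.sin θ ^ 2 ≠ 0)
    (B : E4 →L[ℝ] E4 →L[ℝ] ℝ) (hB : ∀ v w, B v w = B w v) (L : E4 →L[ℝ] ℝ) :
    Real.sin θ * (6 * M * B (E4.basisVector 0) (horizonNull θ φ) + 2 * L (E4.basisVector 0) +
        2 * L (horizonNull θ φ)) +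
      (2 * M * Real.sin θ * (B (E4.basisVector 0) (dPhiHorizonNull θ φ) +
          (B (dPhiHorizonNull θ φ) (horizonNull θ φ) + B (horizonNull θ φ) (dPhiHorizonNull θ φ))) +
        (B (dPhiHatVec M φ) (horizonNull θ φ) + B (phiHatVec M φ) (dPhiHorizonNull θ φ)) +
        (Real.sin θ * B (phiHatVec M φ) (unitPhiVec φ) + L (dUnitPhiVec φ))) +
      (Real.cos θ * (B (thetaVec M θ φ) (horizonNull θ φ) + L (dThetaHorizonNull θ φ)) +
        Real.sin θ * ((B (dThetaVec M θ φ) (horizonNull θ φ) +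
            B (thetaVec M θ φ) (dThetaHorizonNull θ φ)) +
          (B (thetaVec M θ φ) (dThetaHorizonNull θ φ) +
            -(L (horizonNull θ φ) + L (E4.basisVector 0))))) =
    Real.sin θ * (2 * (M ^ 2 * Real.sin θ ^ 2 * B (E4.basisVector 0) (E4.basisVector 0) +
        2 * M ^ 2 * (B (E4.basisVector 0) (horizonNull θ φ) + B (horizonNull θ φ) (E4.basisVector 0)) +
        M * Real.sin θ * (B (E4.basisVector 0) (phiHatVec M φ) + B (phiHatVec M φ) (E4.basisVector 0)) +
        M * Real.sin θ * (B (horizonNull θ φ) (phiHatVec M φ) + B (phiHatVec M φ) (horizonNull θ φ)) +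
        B (thetaVec M θ φ) (thetaVec M θ φ) + B (phiHatVec M φ) (phiHatVec M φ) -
        M ^ 2 * (2 - 2 * Real.sin θ ^ 2) * B (horizonNull θ φ) (horizonNull θ φ)) /
        (M * (2 - Real.sin θ ^ 2))) := by
  rw [mul_div_assoc', eq_div_iff (mul_ne_zero hM h2s)]
  rw [bilin_eq_sum_sum B (E4.basisVector 0) (horizonNull θ φ),
    bilin_eq_sum_sum B (horizonNull θ φ) (E4.basisVector 0),
    bilin_eq_sum_sum B (E4.basisVector 0) (E4.basisVector 0),
    bilin_eq_sum_sum B (E4.basisVector 0) (phiHatVec M φ), bilin_eq_sum_sum B (phiHatVec M φ) (E4.basisVector 0),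
    bilin_eq_sum_sum B (horizonNull θ φ) (phiHatVec M φ), bilin_eq_sum_sum B (phiHatVec M φ) (horizonNull θ φ),
    bilin_eq_sum_sum B (thetaVec M θ φ) (thetaVec M θ φ), bilin_eq_sum_sum B (phiHatVec M φ) (phiHatVec M φ),
    bilin_eq_sum_sum B (horizonNull θ φ) (horizonNull θ φ),
    bilin_eq_sum_sum B (E4.basisVector 0) (dPhiHorizonNull θ φ),
    bilin_eq_sum_sum B (dPhiHorizonNull θ φ) (horizonNull θ φ),
    bilin_eq_sum_sum B (horizonNull θ φ) (dPhiHorizonNull θ φ),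
    bilin_eq_sum_sum B (dPhiHatVec M φ) (horizonNull θ φ),
    bilin_eq_sum_sum B (phiHatVec M φ) (dPhiHorizonNull θ φ),
    bilin_eq_sum_sum B (phiHatVec M φ) (unitPhiVec φ),
    bilin_eq_sum_sum B (thetaVec M θ φ) (horizonNull θ φ),
    bilin_eq_sum_sum B (dThetaVec M θ φ) (horizonNull θ φ),
    bilin_eq_sum_sum B (thetaVec M θ φ) (dThetaHorizonNull θ φ),
    lin_eq_sum L (E4.basisVector 0), lin_eq_sum L (horizonNull θ φ), lin_eq_sum L (dUnitPhiVec φ),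
    lin_eq_sum L (dThetaHorizonNull θ φ)]
  have hb10 : B (E4.basisVector 1) (E4.basisVector 0) = B (E4.basisVector 0) (E4.basisVector 1) := hB _ _
  have hb20 : B (E4.basisVector 2) (E4.basisVector 0) = B (E4.basisVector 0) (E4.basisVector 2) := hB _ _
  have hb30 : B (E4.basisVector 3) (E4.basisVector 0) = B (E4.basisVector 0) (E4.basisVector 3) := hB _ _
  have hb21 : B (E4.basisVector 2) (E4.basisVector 1) = B (E4.basisVector 1) (E4.basisVector 2) := hB _ _
  have hb31 : B (E4.basisVector 3) (E4.basisVector 1) = B (E4.basisVector 1) (E4.basisVector 3) := hB _ _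
  have hb32 : B (E4.basisVector 3) (E4.basisVector 2) = B (E4.basisVector 2) (E4.basisVector 3) := hB _ _
  simp only [Fin.sum_univ_four, horizonNull, thetaVec, phiHatVec, dThetaVec, dPhiHatVec,
    dPhiHorizonNull, dThetaHorizonNull, unitPhiVec, dUnitPhiVec, basisVector_apply, PiLp.toLp_apply,
    Matrix.cons_val_zero, Matrix.cons_val_one, Matrix.cons_val, Fin.isValue, Fin.reduceEq, ↓reduceIte,
    hb10, hb20, hb30, hb21, hb31, hb32]
  have hc3 : Real.cos θ ^ 3 = Real.cos θ * (1 - Real.sin θ ^ 2) := by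
    rw [pow_succ, Real.cos_sq']; ring
  ring_nf
  simp only [hc3, Real.cos_sq']
  ring_nf

/-! ### The second-order horizon identity -/

/-- **The pointwise second-order horizon identity** (the mechanism of Aretakis's Thm. 2 on extremal
Kerr: `Y(ρ² □_g ψ)` restricted to `r = M`). At a horizon point `p = p_σ(θ, φ)`, for a totally symmetric
trilinear form `C` (the third derivative of `Ψ`), a symmetric bilinear form `B` (its Hessian) and a
linear form `L` (its differential):
`sin θ · {M² sin² θ C(T,T,Y) + 4M² C(T,Y,Y) + 6M B(T,Y) + 2L(T) + 2L(Y)} + [∂_φ E₂] + [∂_θ T₂]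
 = sin θ · (2M · W₁ + Σ · W₂)`,
where `W₁ = ∑ g^{μν} B(∂_μ,∂_ν) + ∑ c^ν L(∂_ν)` is the coordinate wave expression at `p`,
`W₂ = ∑ (∂_{ℓ♯} g^{μν}) B(∂_μ,∂_ν) + ∑ g^{μν} C(ℓ♯,∂_μ,∂_ν) + ∑ (∂_{ℓ♯} c^ν) L(∂_ν) + ∑ c^ν B(ℓ♯,∂_ν)` its
derivative along `ℓ♯` (`∂_{ℓ♯} Σ = 2M` on the horizon), and the brackets are the `φ`- and
`θ`-derivatives of the fluxes `E₂ = 2M sin θ (B(T,Y) + B(Y,Y)) + B(Φ̂,Y) + L(n̂)`,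
`T₂ = sin θ (B(Θ,Y) + L(∂_θ Y))`. In the coordinates `(v, r, θ, φ*)` of §5.2 this is
`sin θ · Y(ρ² □_g ψ)|_{r=M} = sin θ (M² sin² θ TTYψ + 4M² TYYψ + 6M TYψ + 2Tψ + 2Yψ)
 + ∂_φ[2M sin θ (TYψ + YYψ) + sin⁻¹θ ∂_φ Yψ] + ∂_θ[sin θ ∂_θ Yψ]`
(Aretakis's `Y(ρ² □_g ψ) = 0` on `𝓗⁺`, §5.2, before Prop. 5.1; Thm. 2, proof).
[cite: Aretakis2015, §5.2 and Thm. 2] -/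
theorem horizon_secondOrder_identity {M : ℝ} (hM : 0 < M) (σ θ φ : ℝ)
    (C : E4 →L[ℝ] E4 →L[ℝ] E4 →L[ℝ] ℝ) (hC₁ : ∀ u v w, C u v w = C v u w)
    (hC₂ : ∀ u v w, C u v w = C u w v)
    (B : E4 →L[ℝ] E4 →L[ℝ] ℝ) (hB : ∀ v w, B v w = B w v) (L : E4 →L[ℝ] ℝ) :
    Real.sin θ * (M ^ 2 * Real.sin θ ^ 2 * C (E4.basisVector 0) (E4.basisVector 0) (horizonNull θ φ) +
        4 * M ^ 2 * C (E4.basisVector 0) (horizonNull θ φ) (horizonNull θ φ) +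
        6 * M * B (E4.basisVector 0) (horizonNull θ φ) + 2 * L (E4.basisVector 0) +
        2 * L (horizonNull θ φ)) +
      (2 * M * Real.sin θ *
          (C (Real.sin θ • phiHatVec M φ) (E4.basisVector 0) (horizonNull θ φ) +
            B (E4.basisVector 0) (dPhiHorizonNull θ φ) +
            (C (Real.sin θ • phiHatVec M φ) (horizonNull θ φ) (horizonNull θ φ) +
              B (dPhiHorizonNull θ φ) (horizonNull θ φ) +
              B (horizonNull θ φ) (dPhiHorizonNull θ φ))) +
        (C (Real.sin θ • phiHatVec M φ) (phiHatVec M φ) (horizonNull θ φ) +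
          B (dPhiHatVec M φ) (horizonNull θ φ) + B (phiHatVec M φ) (dPhiHorizonNull θ φ)) +
        (B (Real.sin θ • phiHatVec M φ) (unitPhiVec φ) + L (dUnitPhiVec φ))) +
      (Real.cos θ * (B (thetaVec M θ φ) (horizonNull θ φ) + L (dThetaHorizonNull θ φ)) +
        Real.sin θ * ((C (thetaVec M θ φ) (thetaVec M θ φ) (horizonNull θ φ) +
            B (dThetaVec M θ φ) (horizonNull θ φ) + B (thetaVec M θ φ) (dThetaHorizonNull θ φ)) +
          (B (thetaVec M θ φ) (dThetaHorizonNull θ φ) + L (-(horizonNull θ φ + E4.basisVector 0))))) =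
    Real.sin θ *
      (2 * M * (∑ μ, ∑ ν, Kerr.inverseMetric M M (horizonPoint M σ θ φ) μ ν *
            B (E4.basisVector μ) (E4.basisVector ν) +
          ∑ ν, Kerr.divInverseMetric M M (horizonPoint M σ θ φ) ν * L (E4.basisVector ν)) +
        Kerr.blSigma M (E4.spatial (horizonPoint M σ θ φ)) *
          (∑ μ, ∑ ν, fderiv ℝ (fun y ↦ Kerr.inverseMetric M M y μ ν) (horizonPoint M σ θ φ)
              (Kerr.nullVector M (horizonPoint M σ θ φ)) * B (E4.basisVector μ) (E4.basisVector ν) +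
            ∑ μ, ∑ ν, Kerr.inverseMetric M M (horizonPoint M σ θ φ) μ ν *
              C (Kerr.nullVector M (horizonPoint M σ θ φ)) (E4.basisVector μ) (E4.basisVector ν) +
            ∑ ν, fderiv ℝ (fun y ↦ Kerr.divInverseMetric M M y ν) (horizonPoint M σ θ φ)
              (Kerr.nullVector M (horizonPoint M σ θ φ)) * L (E4.basisVector ν) +
            ∑ ν, Kerr.divInverseMetric M M (horizonPoint M σ θ φ) ν *
              B (Kerr.nullVector M (horizonPoint M σ θ φ)) (E4.basisVector ν))) := by
  set p := horizonPoint M σ θ φ with hp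
  have hr : Kerr.radius M p = M := radius_horizonPoint hM.le σ θ φ
  have hpos : 0 < Kerr.radius M p := by rw [hr]; exact hM
  have hSpos := Kerr.blSigma_spatial_pos hpos
  have hS : Kerr.blSigma M (E4.spatial p) = M ^ 2 * (2 - Real.sin θ ^ 2) := blSigma_horizonPoint hM.le σ θ φ
  have hV : Kerr.nullVector M p = horizonNull θ φ := nullVector_horizonPoint hM σ θ φ
  set S := Kerr.blSigma M (E4.spatial p) with hSdef
  have hS0 : S ≠ 0 := hSpos.ne'
  -- (1) `Σ W₁ = P_B − 2M L(Y)`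
  have hgB := blSigma_mul_sum_inverseMetric_horizon hM σ θ φ B
  rw [← hp, ← hSdef] at hgB
  have hcL : S * ∑ ν, Kerr.divInverseMetric M M p ν * L (E4.basisVector ν) =
      -(2 * M) * L (horizonNull θ φ) := by
    have hc : ∀ ν, Kerr.divInverseMetric M M p ν * L (E4.basisVector ν) =
        -(2 * M / S) * (L (E4.basisVector ν) * Kerr.nullVector M p ν) := by
      intro ν; rw [Kerr.divInverseMetric_eq M M hpos ν]; ring
    simp only [hc]
    rw [← Finset.mul_sum, Kerr.sum_apply_basisVector_mul_nullVector L M p, hV]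
    field_simp
  -- (2) the four pieces of `W₂`
  have hdgB : S ^ 2 * ∑ μ, ∑ ν, fderiv ℝ (fun y ↦ Kerr.inverseMetric M M y μ ν) p
      (Kerr.nullVector M p) * B (E4.basisVector μ) (E4.basisVector ν) =
      2 * M ^ 3 * Real.sin θ ^ 2 * B (horizonNull θ φ) (horizonNull θ φ) := by
    have h1 : ∀ μ ν, S ^ 2 * (fderiv ℝ (fun y ↦ Kerr.inverseMetric M M y μ ν) p
        (Kerr.nullVector M p) * B (E4.basisVector μ) (E4.basisVector ν)) =
        2 * M ^ 3 * Real.sin θ ^ 2 * (horizonNull θ φ μ * horizonNull θ φ ν *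
          B (E4.basisVector μ) (E4.basisVector ν)) := by
      intro μ ν
      have h := blSigma_sq_mul_fderiv_inverseMetric_horizon hM σ θ φ μ ν
      rw [← hp, ← hSdef] at h
      rw [← mul_assoc, h]
      ring
    rw [bilin_eq_sum_sum B (horizonNull θ φ) (horizonNull θ φ), Finset.mul_sum, Finset.mul_sum]
    refine Finset.sum_congr rfl fun μ _ ↦ ?_
    rw [Finset.mul_sum, Finset.mul_sum]
    exact Finset.sum_congr rfl fun ν _ ↦ h1 μ ν
  have hgC := blSigma_mul_sum_inverseMetric_horizon hM σ θ φ (C (horizonNull θ φ))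
  rw [← hp, ← hSdef] at hgC
  have hdcL : S ^ 2 * ∑ ν, fderiv ℝ (fun y ↦ Kerr.divInverseMetric M M y ν) p
      (Kerr.nullVector M p) * L (E4.basisVector ν) = 4 * M ^ 2 * L (horizonNull θ φ) := by
    have h1 : ∀ ν, S ^ 2 * (fderiv ℝ (fun y ↦ Kerr.divInverseMetric M M y ν) p
        (Kerr.nullVector M p) * L (E4.basisVector ν)) =
        4 * M ^ 2 * (horizonNull θ φ ν * L (E4.basisVector ν)) := by
      intro ν
      have h := blSigma_sq_mul_fderiv_divInverseMetric_horizon hM σ θ φ ν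
      rw [← hp, ← hSdef] at h
      rw [← mul_assoc, h]
      ring
    rw [Finset.mul_sum]
    simp only [h1]
    rw [← Finset.mul_sum, ← lin_eq_sum L (horizonNull θ φ)]
  have hcB : S * ∑ ν, Kerr.divInverseMetric M M p ν * B (Kerr.nullVector M p) (E4.basisVector ν) =
      -(2 * M) * B (horizonNull θ φ) (horizonNull θ φ) := by
    have hc : ∀ ν, Kerr.divInverseMetric M M p ν * B (Kerr.nullVector M p) (E4.basisVector ν) =
        -(2 * M / S) * (B (Kerr.nullVector M p) (E4.basisVector ν) * Kerr.nullVector M p ν) := by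
      intro ν; rw [Kerr.divInverseMetric_eq M M hpos ν]; ring
    simp only [hc]
    rw [← Finset.mul_sum, Kerr.sum_apply_basisVector_mul_nullVector (B (Kerr.nullVector M p)) M p, hV]
    field_simp
  -- (3) hence `2M W₁ + Σ W₂ = 2 (P_B − 2M² cos²θ B(Y,Y)) / (M (2 − sin²θ)) + P_{C(Y)}`
  have hs1 : Real.sin θ ^ 2 ≤ 1 := Real.sin_sq_le_one θ
  have h2s : (2 : ℝ) - Real.sin θ ^ 2 ≠ 0 := (sub_pos.mpr (lt_of_le_of_lt hs1 one_lt_two)).ne'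
  have hM0 : M ≠ 0 := hM.ne'
  have hRHS : 2 * M * (∑ μ, ∑ ν, Kerr.inverseMetric M M p μ ν * B (E4.basisVector μ) (E4.basisVector ν) +
        ∑ ν, Kerr.divInverseMetric M M p ν * L (E4.basisVector ν)) +
      S * (∑ μ, ∑ ν, fderiv ℝ (fun y ↦ Kerr.inverseMetric M M y μ ν) p (Kerr.nullVector M p) *
            B (E4.basisVector μ) (E4.basisVector ν) +
          ∑ μ, ∑ ν, Kerr.inverseMetric M M p μ ν * C (Kerr.nullVector M p) (E4.basisVector μ) (E4.basisVector ν) +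
          ∑ ν, fderiv ℝ (fun y ↦ Kerr.divInverseMetric M M y ν) p (Kerr.nullVector M p) * L (E4.basisVector ν) +
          ∑ ν, Kerr.divInverseMetric M M p ν * B (Kerr.nullVector M p) (E4.basisVector ν)) =
      2 * (M ^ 2 * Real.sin θ ^ 2 * B (E4.basisVector 0) (E4.basisVector 0) +
          2 * M ^ 2 * (B (E4.basisVector 0) (horizonNull θ φ) + B (horizonNull θ φ) (E4.basisVector 0)) +
          M * Real.sin θ * (B (E4.basisVector 0) (phiHatVec M φ) + B (phiHatVec M φ) (E4.basisVector 0)) +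
          M * Real.sin θ * (B (horizonNull θ φ) (phiHatVec M φ) + B (phiHatVec M φ) (horizonNull θ φ)) +
          B (thetaVec M θ φ) (thetaVec M θ φ) + B (phiHatVec M φ) (phiHatVec M φ) -
          M ^ 2 * (2 - 2 * Real.sin θ ^ 2) * B (horizonNull θ φ) (horizonNull θ φ)) /
          (M * (2 - Real.sin θ ^ 2)) +
        (M ^ 2 * Real.sin θ ^ 2 * C (horizonNull θ φ) (E4.basisVector 0) (E4.basisVector 0) +
          2 * M ^ 2 * (C (horizonNull θ φ) (E4.basisVector 0) (horizonNull θ φ) +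
            C (horizonNull θ φ) (horizonNull θ φ) (E4.basisVector 0)) +
          M * Real.sin θ * (C (horizonNull θ φ) (E4.basisVector 0) (phiHatVec M φ) +
            C (horizonNull θ φ) (phiHatVec M φ) (E4.basisVector 0)) +
          M * Real.sin θ * (C (horizonNull θ φ) (horizonNull θ φ) (phiHatVec M φ) +
            C (horizonNull θ φ) (phiHatVec M φ) (horizonNull θ φ)) +
          C (horizonNull θ φ) (thetaVec M θ φ) (thetaVec M θ φ) +
          C (horizonNull θ φ) (phiHatVec M φ) (phiHatVec M φ)) := by
    rw [div_add' _ _ _ (mul_ne_zero hM0 h2s), eq_div_iff (mul_ne_zero hM0 h2s)]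
    rw [hV] at hdgB hdcL hcB ⊢
    -- multiply out with `S = M² (2 − sin²θ)`
    have e1 : (2 * M * (∑ μ, ∑ ν, Kerr.inverseMetric M M p μ ν * B (E4.basisVector μ) (E4.basisVector ν) +
          ∑ ν, Kerr.divInverseMetric M M p ν * L (E4.basisVector ν)) +
        S * (∑ μ, ∑ ν, fderiv ℝ (fun y ↦ Kerr.inverseMetric M M y μ ν) p (horizonNull θ φ) *
              B (E4.basisVector μ) (E4.basisVector ν) +
            ∑ μ, ∑ ν, Kerr.inverseMetric M M p μ ν * C (horizonNull θ φ) (E4.basisVector μ) (E4.basisVector ν) +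
            ∑ ν, fderiv ℝ (fun y ↦ Kerr.divInverseMetric M M y ν) p (horizonNull θ φ) * L (E4.basisVector ν) +
            ∑ ν, Kerr.divInverseMetric M M p ν * B (horizonNull θ φ) (E4.basisVector ν))) *
          (M * (2 - Real.sin θ ^ 2)) * S ^ 2 =
        (M * (2 - Real.sin θ ^ 2)) * (2 * M * S *
          (S * ∑ μ, ∑ ν, Kerr.inverseMetric M M p μ ν * B (E4.basisVector μ) (E4.basisVector ν)) +
          2 * M * S * (S * ∑ ν, Kerr.divInverseMetric M M p ν * L (E4.basisVector ν)) +
          S * (S ^ 2 * ∑ μ, ∑ ν, fderiv ℝ (fun y ↦ Kerr.inverseMetric M M y μ ν) p (horizonNull θ φ) *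
              B (E4.basisVector μ) (E4.basisVector ν)) +
          S ^ 2 * (S * ∑ μ, ∑ ν, Kerr.inverseMetric M M p μ ν *
              C (horizonNull θ φ) (E4.basisVector μ) (E4.basisVector ν)) +
          S * (S ^ 2 * ∑ ν, fderiv ℝ (fun y ↦ Kerr.divInverseMetric M M y ν) p (horizonNull θ φ) *
              L (E4.basisVector ν)) +
          S ^ 2 * (S * ∑ ν, Kerr.divInverseMetric M M p ν * B (horizonNull θ φ) (E4.basisVector ν))) := by
      ring
    have hS20 : S ^ 2 ≠ 0 := pow_ne_zero 2 hS0
    refine mul_right_cancel₀ hS20 ?_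
    rw [e1, hgB, hcL, hdgB, hgC, hdcL, hcB, hS]
    ring
  rw [hRHS]
  -- (4) the `C`-part (symmetry only) and the `B, L`-part (coordinates)
  have hCpart := secondOrder_alg_C M θ φ C hC₁ hC₂
  have hBLpart := secondOrder_alg_BL θ φ hM0 h2s B hB L
  simp only [map_smul, FunLike.coe_smul, Pi.smul_apply, smul_eq_mul, map_neg, map_add]
  linear_combination hCpart + hBLpart

/-! ### Symmetries of third derivatives of smooth functions -/

/-- Swap of the first two slots of `D³Φ(z)`. [folklore] -/
theorem fderiv_fderiv_fderiv_swap12 {Φ : E4 → ℝ} (hΦ : ContDiff ℝ ∞ Φ) (z u v w : E4) :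
    fderiv ℝ (fderiv ℝ (fderiv ℝ Φ)) z u v w = fderiv ℝ (fderiv ℝ (fderiv ℝ Φ)) z v u w := by
  have h1 : ContDiff ℝ ∞ (fderiv ℝ Φ) := hΦ.fderiv_right (m := ∞) le_rfl
  have h := (h1.contDiffAt (x := z)).isSymmSndFDerivAt minSmoothness_two_le_infty u v
  rw [h]

/-- Swap of the last two slots of `D³Φ(z)`. [folklore] -/
theorem fderiv_fderiv_fderiv_swap23 {Φ : E4 → ℝ} (hΦ : ContDiff ℝ ∞ Φ) (z u v w : E4) :
    fderiv ℝ (fderiv ℝ (fderiv ℝ Φ)) z u v w = fderiv ℝ (fderiv ℝ (fderiv ℝ Φ)) z u w v := by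
  rw [fderiv_fderiv_fderiv_cyclic hΦ z u w v, fderiv_fderiv_fderiv_swap12 hΦ z v u w]

/-! ### The second-order density and fluxes of a function as functions of `(σ, θ, φ)` -/

/-- The **second-order density** `(M² sin² θ · TYΨ + 4M² · YYΨ + 6M · YΨ + 2Ψ)(p_σ(θ, φ)) · 2M² sin θ`
(the `T`-antiderivative of the `T`-terms of `Y(ρ² □_g ψ)` on the horizon, against the area element).
[cite: Aretakis2015, §5.2 and Thm. 2] -/
def secondDensity (M : ℝ) (Ψ : E4 → ℝ) (σ θ φ : ℝ) : ℝ :=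
  (M ^ 2 * Real.sin θ ^ 2 *
      fderiv ℝ (fderiv ℝ Ψ) (horizonPoint M σ θ φ) (E4.basisVector 0) (horizonNull θ φ) +
    4 * M ^ 2 * fderiv ℝ (fderiv ℝ Ψ) (horizonPoint M σ θ φ) (horizonNull θ φ) (horizonNull θ φ) +
    6 * M * fderiv ℝ Ψ (horizonPoint M σ θ φ) (horizonNull θ φ) +
    2 * Ψ (horizonPoint M σ θ φ)) * (2 * M ^ 2 * Real.sin θ)

/-- The second-order azimuthal flux `E₂ = 2M sin θ (TYΨ + YYΨ) + Φ̂YΨ + n̂Ψ`. [cite: Aretakis2015, Thm. 2] -/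
def secondPhiFlux (M : ℝ) (Ψ : E4 → ℝ) (σ θ φ : ℝ) : ℝ :=
  2 * M * Real.sin θ *
      (fderiv ℝ (fderiv ℝ Ψ) (horizonPoint M σ θ φ) (E4.basisVector 0) (horizonNull θ φ) +
        fderiv ℝ (fderiv ℝ Ψ) (horizonPoint M σ θ φ) (horizonNull θ φ) (horizonNull θ φ)) +
    fderiv ℝ (fderiv ℝ Ψ) (horizonPoint M σ θ φ) (phiHatVec M φ) (horizonNull θ φ) +
    fderiv ℝ Ψ (horizonPoint M σ θ φ) (unitPhiVec φ)

/-- The second-order polar flux `T₂ = sin θ (ΘYΨ + (∂_θ ℓ♯)Ψ)` (vanishing at the poles).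
[cite: Aretakis2015, Thm. 2] -/
def secondThetaFlux (M : ℝ) (Ψ : E4 → ℝ) (σ θ φ : ℝ) : ℝ :=
  Real.sin θ * (fderiv ℝ (fderiv ℝ Ψ) (horizonPoint M σ θ φ) (thetaVec M θ φ) (horizonNull θ φ) +
    fderiv ℝ Ψ (horizonPoint M σ θ φ) (dThetaHorizonNull θ φ))

/-- The `φ`-derivative of `E₂` as a function. [folklore] -/
def secondPhiFluxDeriv (M : ℝ) (Ψ : E4 → ℝ) (σ θ φ : ℝ) : ℝ :=
  2 * M * Real.sin θ *
      (fderiv ℝ (fderiv ℝ (fderiv ℝ Ψ)) (horizonPoint M σ θ φ) (Real.sin θ • phiHatVec M φ)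
          (E4.basisVector 0) (horizonNull θ φ) +
        fderiv ℝ (fderiv ℝ Ψ) (horizonPoint M σ θ φ) (E4.basisVector 0) (dPhiHorizonNull θ φ) +
        (fderiv ℝ (fderiv ℝ (fderiv ℝ Ψ)) (horizonPoint M σ θ φ) (Real.sin θ • phiHatVec M φ)
            (horizonNull θ φ) (horizonNull θ φ) +
          fderiv ℝ (fderiv ℝ Ψ) (horizonPoint M σ θ φ) (dPhiHorizonNull θ φ) (horizonNull θ φ) +
          fderiv ℝ (fderiv ℝ Ψ) (horizonPoint M σ θ φ) (horizonNull θ φ) (dPhiHorizonNull θ φ))) +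
    (fderiv ℝ (fderiv ℝ (fderiv ℝ Ψ)) (horizonPoint M σ θ φ) (Real.sin θ • phiHatVec M φ)
        (phiHatVec M φ) (horizonNull θ φ) +
      fderiv ℝ (fderiv ℝ Ψ) (horizonPoint M σ θ φ) (dPhiHatVec M φ) (horizonNull θ φ) +
      fderiv ℝ (fderiv ℝ Ψ) (horizonPoint M σ θ φ) (phiHatVec M φ) (dPhiHorizonNull θ φ)) +
    (fderiv ℝ (fderiv ℝ Ψ) (horizonPoint M σ θ φ) (Real.sin θ • phiHatVec M φ) (unitPhiVec φ) +
      fderiv ℝ Ψ (horizonPoint M σ θ φ) (dUnitPhiVec φ))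

/-- The `θ`-derivative of `T₂` as a function. [folklore] -/
def secondThetaFluxDeriv (M : ℝ) (Ψ : E4 → ℝ) (σ θ φ : ℝ) : ℝ :=
  Real.cos θ * (fderiv ℝ (fderiv ℝ Ψ) (horizonPoint M σ θ φ) (thetaVec M θ φ) (horizonNull θ φ) +
      fderiv ℝ Ψ (horizonPoint M σ θ φ) (dThetaHorizonNull θ φ)) +
    Real.sin θ *
      ((fderiv ℝ (fderiv ℝ (fderiv ℝ Ψ)) (horizonPoint M σ θ φ) (thetaVec M θ φ) (thetaVec M θ φ)
            (horizonNull θ φ) +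
          fderiv ℝ (fderiv ℝ Ψ) (horizonPoint M σ θ φ) (dThetaVec M θ φ) (horizonNull θ φ) +
          fderiv ℝ (fderiv ℝ Ψ) (horizonPoint M σ θ φ) (thetaVec M θ φ) (dThetaHorizonNull θ φ)) +
        (fderiv ℝ (fderiv ℝ Ψ) (horizonPoint M σ θ φ) (thetaVec M θ φ) (dThetaHorizonNull θ φ) +
          fderiv ℝ Ψ (horizonPoint M σ θ φ) (-(horizonNull θ φ + E4.basisVector 0))))

/-- The `σ`-derivative of the second-order density, before use of the wave equation. [folklore] -/
def secondDensityDeriv (M : ℝ) (Ψ : E4 → ℝ) (σ θ φ : ℝ) : ℝ :=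
  2 * M ^ 2 * Real.sin θ *
    (M ^ 2 * Real.sin θ ^ 2 * fderiv ℝ (fderiv ℝ (fderiv ℝ Ψ)) (horizonPoint M σ θ φ)
        (E4.basisVector 0) (E4.basisVector 0) (horizonNull θ φ) +
      4 * M ^ 2 * fderiv ℝ (fderiv ℝ (fderiv ℝ Ψ)) (horizonPoint M σ θ φ) (E4.basisVector 0)
        (horizonNull θ φ) (horizonNull θ φ) +
      6 * M * fderiv ℝ (fderiv ℝ Ψ) (horizonPoint M σ θ φ) (E4.basisVector 0) (horizonNull θ φ) +
      2 * fderiv ℝ Ψ (horizonPoint M σ θ φ) (E4.basisVector 0))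

/-- The second-order polar flux vanishes at the poles. [folklore] -/
theorem secondThetaFlux_zero (M : ℝ) (Ψ : E4 → ℝ) (σ φ : ℝ) : secondThetaFlux M Ψ σ 0 φ = 0 := by
  simp [secondThetaFlux]

/-- The second-order polar flux vanishes at the poles. [folklore] -/
theorem secondThetaFlux_pi (M : ℝ) (Ψ : E4 → ℝ) (σ φ : ℝ) : secondThetaFlux M Ψ σ Real.pi φ = 0 := by
  simp [secondThetaFlux]

/-- The second-order azimuthal flux is `2π`-periodic. [folklore] -/
theorem secondPhiFlux_add_two_pi (M : ℝ) (Ψ : E4 → ℝ) (σ θ φ : ℝ) :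
    secondPhiFlux M Ψ σ θ (φ + 2 * Real.pi) = secondPhiFlux M Ψ σ θ φ := by
  simp only [secondPhiFlux, horizonPoint_add_two_pi, horizonNull, phiHatVec, unitPhiVec,
    Real.cos_add_two_pi, Real.sin_add_two_pi]

section Derivatives2

variable {M : ℝ} {Ψ : E4 → ℝ}

/-- **`∂_σ` of the second-order density.** [cite: Aretakis2015, Thm. 2] -/
theorem hasDerivAt_secondDensity_sigma (hΨ : ContDiff ℝ ∞ Ψ) (σ θ φ : ℝ) :
    HasDerivAt (fun σ' ↦ secondDensity M Ψ σ' θ φ) (secondDensityDeriv M Ψ σ θ φ) σ := by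
  set p := horizonPoint M σ θ φ with hp
  have hd0 : Differentiable ℝ Ψ := hΨ.differentiable (WithTop.coe_ne_zero.mpr ENat.top_ne_zero)
  have h1c : ContDiff ℝ ∞ (fderiv ℝ Ψ) := hΨ.fderiv_right (m := ∞) le_rfl
  have hd1 : Differentiable ℝ (fderiv ℝ Ψ) := h1c.differentiable (WithTop.coe_ne_zero.mpr ENat.top_ne_zero)
  have hd2 : Differentiable ℝ (fderiv ℝ (fderiv ℝ Ψ)) :=
    (h1c.fderiv_right (m := ∞) le_rfl).differentiable (WithTop.coe_ne_zero.mpr ENat.top_ne_zero)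
  have hcurve : HasDerivAt (fun σ' ↦ horizonPoint M σ' θ φ) (E4.basisVector 0) σ :=
    hasDerivAt_horizonPoint_sigma M σ θ φ
  have hC2 : HasFDerivAt (fderiv ℝ (fderiv ℝ Ψ)) (fderiv ℝ (fderiv ℝ (fderiv ℝ Ψ)) (horizonPoint M σ θ φ))
      (horizonPoint M σ θ φ) := (hd2 _).hasFDerivAt
  have hB1 : HasFDerivAt (fderiv ℝ Ψ) (fderiv ℝ (fderiv ℝ Ψ) p) p := (hd1 p).hasFDerivAt
  have hL0 : HasFDerivAt Ψ (fderiv ℝ Ψ p) p := (hd0 p).hasFDerivAt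
  have hC := HasFDerivAt.comp_hasDerivAt (l := fderiv ℝ (fderiv ℝ Ψ)) σ hC2 hcurve
  have hB : HasDerivAt (fun σ' ↦ fderiv ℝ Ψ (horizonPoint M σ' θ φ))
      (fderiv ℝ (fderiv ℝ Ψ) p (E4.basisVector 0)) σ := hB1.comp_hasDerivAt σ hcurve
  have h0 : HasDerivAt (fun σ' ↦ Ψ (horizonPoint M σ' θ φ)) (fderiv ℝ Ψ p (E4.basisVector 0)) σ :=
    hL0.comp_hasDerivAt σ hcurve
  have hCT : HasDerivAt (fun σ' ↦ fderiv ℝ (fderiv ℝ Ψ) (horizonPoint M σ' θ φ) (E4.basisVector 0))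
      (fderiv ℝ (fderiv ℝ (fderiv ℝ Ψ)) p (E4.basisVector 0) (E4.basisVector 0)) σ := by
    simpa using hC.clm_apply (hasDerivAt_const σ (E4.basisVector 0))
  have hCY : HasDerivAt (fun σ' ↦ fderiv ℝ (fderiv ℝ Ψ) (horizonPoint M σ' θ φ) (horizonNull θ φ))
      (fderiv ℝ (fderiv ℝ (fderiv ℝ Ψ)) p (E4.basisVector 0) (horizonNull θ φ)) σ := by
    simpa using hC.clm_apply (hasDerivAt_const σ (horizonNull θ φ))
  have h1 : HasDerivAt (fun σ' ↦ fderiv ℝ (fderiv ℝ Ψ) (horizonPoint M σ' θ φ) (E4.basisVector 0)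
      (horizonNull θ φ))
      (fderiv ℝ (fderiv ℝ (fderiv ℝ Ψ)) p (E4.basisVector 0) (E4.basisVector 0) (horizonNull θ φ)) σ := by
    simpa using hCT.clm_apply (hasDerivAt_const σ (horizonNull θ φ))
  have h2 : HasDerivAt (fun σ' ↦ fderiv ℝ (fderiv ℝ Ψ) (horizonPoint M σ' θ φ) (horizonNull θ φ)
      (horizonNull θ φ))
      (fderiv ℝ (fderiv ℝ (fderiv ℝ Ψ)) p (E4.basisVector 0) (horizonNull θ φ) (horizonNull θ φ)) σ := by
    simpa using hCY.clm_apply (hasDerivAt_const σ (horizonNull θ φ))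
  have h3 : HasDerivAt (fun σ' ↦ fderiv ℝ Ψ (horizonPoint M σ' θ φ) (horizonNull θ φ))
      (fderiv ℝ (fderiv ℝ Ψ) p (E4.basisVector 0) (horizonNull θ φ)) σ := by
    simpa using hB.clm_apply (hasDerivAt_const σ (horizonNull θ φ))
  have h := ((((h1.const_mul (M ^ 2 * Real.sin θ ^ 2)).add (h2.const_mul (4 * M ^ 2))).add
    (h3.const_mul (6 * M))).add (h0.const_mul 2)).mul_const (2 * M ^ 2 * Real.sin θ)
  refine (h.congr_of_eventuallyEq (Eventually.of_forall fun σ' ↦ rfl)).congr_deriv ?_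
  rw [secondDensityDeriv, hp]
  ring

/-- **`∂_φ` of the second-order azimuthal flux.** [folklore] -/
theorem hasDerivAt_secondPhiFlux_phi (hΨ : ContDiff ℝ ∞ Ψ) (σ θ φ : ℝ) :
    HasDerivAt (fun φ' ↦ secondPhiFlux M Ψ σ θ φ') (secondPhiFluxDeriv M Ψ σ θ φ) φ := by
  set p := horizonPoint M σ θ φ with hp
  have h1c : ContDiff ℝ ∞ (fderiv ℝ Ψ) := hΨ.fderiv_right (m := ∞) le_rfl
  have hd1 : Differentiable ℝ (fderiv ℝ Ψ) := h1c.differentiable (WithTop.coe_ne_zero.mpr ENat.top_ne_zero)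
  have hd2 : Differentiable ℝ (fderiv ℝ (fderiv ℝ Ψ)) :=
    (h1c.fderiv_right (m := ∞) le_rfl).differentiable (WithTop.coe_ne_zero.mpr ENat.top_ne_zero)
  have hcurve := hasDerivAt_horizonPoint_phi M σ θ φ
  have hC2 : HasFDerivAt (fderiv ℝ (fderiv ℝ Ψ)) (fderiv ℝ (fderiv ℝ (fderiv ℝ Ψ)) (horizonPoint M σ θ φ))
      (horizonPoint M σ θ φ) := (hd2 _).hasFDerivAt
  have hB1 : HasFDerivAt (fderiv ℝ Ψ) (fderiv ℝ (fderiv ℝ Ψ) p) p := (hd1 p).hasFDerivAt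
  have hC := HasFDerivAt.comp_hasDerivAt (l := fderiv ℝ (fderiv ℝ Ψ)) φ hC2 hcurve
  have hB : HasDerivAt (fun φ' ↦ fderiv ℝ Ψ (horizonPoint M σ θ φ'))
      (fderiv ℝ (fderiv ℝ Ψ) p (Real.sin θ • phiHatVec M φ)) φ := hB1.comp_hasDerivAt φ hcurve
  have hY := hasDerivAt_horizonNull_phi θ φ
  have hCT : HasDerivAt (fun φ' ↦ fderiv ℝ (fderiv ℝ Ψ) (horizonPoint M σ θ φ') (E4.basisVector 0))
      (fderiv ℝ (fderiv ℝ (fderiv ℝ Ψ)) p (Real.sin θ • phiHatVec M φ) (E4.basisVector 0)) φ := by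
    simpa using hC.clm_apply (hasDerivAt_const φ (E4.basisVector 0))
  have h1 := hCT.clm_apply hY
  have h2 := (hC.clm_apply hY).clm_apply hY
  have h3 := (hC.clm_apply (hasDerivAt_phiHatVec M φ)).clm_apply hY
  have h4 := hB.clm_apply (hasDerivAt_unitPhiVec φ)
  have h := (((h1.add h2).const_mul (2 * M * Real.sin θ)).add h3).add h4
  refine (h.congr_of_eventuallyEq (Eventually.of_forall fun φ' ↦ rfl)).congr_deriv ?_
  simp only [secondPhiFluxDeriv, hp, FunLike.coe_add, Pi.add_apply, Function.comp_apply]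

/-- **`∂_θ` of the second-order polar flux.** [folklore] -/
theorem hasDerivAt_secondThetaFlux_theta (hΨ : ContDiff ℝ ∞ Ψ) (σ θ φ : ℝ) :
    HasDerivAt (fun θ' ↦ secondThetaFlux M Ψ σ θ' φ) (secondThetaFluxDeriv M Ψ σ θ φ) θ := by
  set p := horizonPoint M σ θ φ with hp
  have h1c : ContDiff ℝ ∞ (fderiv ℝ Ψ) := hΨ.fderiv_right (m := ∞) le_rfl
  have hd1 : Differentiable ℝ (fderiv ℝ Ψ) := h1c.differentiable (WithTop.coe_ne_zero.mpr ENat.top_ne_zero)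
  have hd2 : Differentiable ℝ (fderiv ℝ (fderiv ℝ Ψ)) :=
    (h1c.fderiv_right (m := ∞) le_rfl).differentiable (WithTop.coe_ne_zero.mpr ENat.top_ne_zero)
  have hcurve := hasDerivAt_horizonPoint_theta M σ θ φ
  have hC2 : HasFDerivAt (fderiv ℝ (fderiv ℝ Ψ)) (fderiv ℝ (fderiv ℝ (fderiv ℝ Ψ)) (horizonPoint M σ θ φ))
      (horizonPoint M σ θ φ) := (hd2 _).hasFDerivAt
  have hB1 : HasFDerivAt (fderiv ℝ Ψ) (fderiv ℝ (fderiv ℝ Ψ) p) p := (hd1 p).hasFDerivAt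
  have hC := HasFDerivAt.comp_hasDerivAt (l := fderiv ℝ (fderiv ℝ Ψ)) θ hC2 hcurve
  have hB : HasDerivAt (fun θ' ↦ fderiv ℝ Ψ (horizonPoint M σ θ' φ))
      (fderiv ℝ (fderiv ℝ Ψ) p (thetaVec M θ φ)) θ := hB1.comp_hasDerivAt θ hcurve
  have hY := hasDerivAt_horizonNull_theta θ φ
  have h1 := (hC.clm_apply (hasDerivAt_thetaVec M θ φ)).clm_apply hY
  have h2 := hB.clm_apply (hasDerivAt_dThetaHorizonNull_theta θ φ)
  have h := ((Real.hasDerivAt_cos θ).smul_const (0 : ℝ)).add ((Real.hasDerivAt_sin θ).mul (h1.add h2))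
  have hfun : (fun θ' ↦ secondThetaFlux M Ψ σ θ' φ) = fun θ' ↦ Real.cos θ' • (0 : ℝ) +
      Real.sin θ' * (fderiv ℝ (fderiv ℝ Ψ) (horizonPoint M σ θ' φ) (thetaVec M θ' φ) (horizonNull θ' φ) +
        fderiv ℝ Ψ (horizonPoint M σ θ' φ) (dThetaHorizonNull θ' φ)) := by
    funext θ'; simp [secondThetaFlux]
  rw [hfun]
  refine h.congr_deriv ?_
  simp only [secondThetaFluxDeriv, hp, FunLike.coe_add, Pi.add_apply, Function.comp_apply, smul_zero, zero_add]

end Derivatives2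

/-! ### The `σ`-derivative of the second-order density for a solution -/

/-- **The `σ`-derivative of the second-order density for a solution.** If at the horizon point
`p = p_σ(θ, φ)` both the coordinate wave expression `W₁ = ∑ g^{μν} ∂_μ∂_ν Ψ + ∑ c^ν ∂_ν Ψ` and its
derivative `W₂` along `ℓ♯` vanish, then
`∂_σ D₂ = −2M² (∂_φ E₂ + ∂_θ T₂) − 4M² sin θ · YΨ(p)` (`horizon_secondOrder_identity`).
[cite: Aretakis2015, Thm. 2 and §5.2] -/
theorem hasDerivAt_secondDensity_of_wave {M : ℝ} (hM : 0 < M) {Ψ : E4 → ℝ} (hΨ : ContDiff ℝ ∞ Ψ)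
    (σ θ φ : ℝ)
    (hW₁ : ∑ μ, ∑ ν, Kerr.inverseMetric M M (horizonPoint M σ θ φ) μ ν *
        fderiv ℝ (fderiv ℝ Ψ) (horizonPoint M σ θ φ) (E4.basisVector μ) (E4.basisVector ν) +
      ∑ ν, Kerr.divInverseMetric M M (horizonPoint M σ θ φ) ν *
        fderiv ℝ Ψ (horizonPoint M σ θ φ) (E4.basisVector ν) = 0)
    (hW₂ : ∑ μ, ∑ ν, fderiv ℝ (fun y ↦ Kerr.inverseMetric M M y μ ν) (horizonPoint M σ θ φ)
          (Kerr.nullVector M (horizonPoint M σ θ φ)) *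
          fderiv ℝ (fderiv ℝ Ψ) (horizonPoint M σ θ φ) (E4.basisVector μ) (E4.basisVector ν) +
      ∑ μ, ∑ ν, Kerr.inverseMetric M M (horizonPoint M σ θ φ) μ ν *
        fderiv ℝ (fderiv ℝ (fderiv ℝ Ψ)) (horizonPoint M σ θ φ)
          (Kerr.nullVector M (horizonPoint M σ θ φ)) (E4.basisVector μ) (E4.basisVector ν) +
      ∑ ν, fderiv ℝ (fun y ↦ Kerr.divInverseMetric M M y ν) (horizonPoint M σ θ φ)
          (Kerr.nullVector M (horizonPoint M σ θ φ)) * fderiv ℝ Ψ (horizonPoint M σ θ φ) (E4.basisVector ν) +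
      ∑ ν, Kerr.divInverseMetric M M (horizonPoint M σ θ φ) ν *
        fderiv ℝ (fderiv ℝ Ψ) (horizonPoint M σ θ φ) (Kerr.nullVector M (horizonPoint M σ θ φ))
          (E4.basisVector ν) = 0) :
    HasDerivAt (fun σ' ↦ secondDensity M Ψ σ' θ φ)
      (-(2 * M ^ 2) * (secondPhiFluxDeriv M Ψ σ θ φ + secondThetaFluxDeriv M Ψ σ θ φ) +
        -(4 * M ^ 2) * (Real.sin θ * fderiv ℝ Ψ (horizonPoint M σ θ φ) (horizonNull θ φ))) σ := by
  have hd := hasDerivAt_secondDensity_sigma (M := M) hΨ σ θ φ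
  have hid := horizon_secondOrder_identity hM σ θ φ (fderiv ℝ (fderiv ℝ (fderiv ℝ Ψ)) (horizonPoint M σ θ φ))
    (fderiv_fderiv_fderiv_swap12 hΨ _) (fderiv_fderiv_fderiv_swap23 hΨ _)
    (fderiv ℝ (fderiv ℝ Ψ) (horizonPoint M σ θ φ))
    (fun v w ↦ (hΨ.contDiffAt.isSymmSndFDerivAt minSmoothness_two_le_infty) v w)
    (fderiv ℝ Ψ (horizonPoint M σ θ φ))
  rw [hW₁, hW₂, mul_zero, mul_zero, add_zero, mul_zero] at hid
  refine hd.congr_deriv ?_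
  simp only [secondDensityDeriv, secondPhiFluxDeriv, secondThetaFluxDeriv]
  linear_combination (2 * M ^ 2) * hid

/-! ### Continuity of the second-order expressions -/

section Continuity2

variable {M : ℝ} {Ψ : E4 → ℝ}

/-- Continuity of the frame-vector fields in `(σ, θ, φ)` (components are trigonometric polynomials).
[folklore] -/
theorem continuous_frames :
    (Continuous fun q : ℝ × ℝ × ℝ ↦ horizonNull q.2.1 q.2.2) ∧
    (Continuous fun q : ℝ × ℝ × ℝ ↦ thetaVec M q.2.1 q.2.2) ∧
    (Continuous fun q : ℝ × ℝ × ℝ ↦ dThetaVec M q.2.1 q.2.2) ∧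
    (Continuous fun q : ℝ × ℝ × ℝ ↦ phiHatVec M q.2.2) ∧
    (Continuous fun q : ℝ × ℝ × ℝ ↦ dPhiHatVec M q.2.2) ∧
    (Continuous fun q : ℝ × ℝ × ℝ ↦ dPhiHorizonNull q.2.1 q.2.2) ∧
    (Continuous fun q : ℝ × ℝ × ℝ ↦ dThetaHorizonNull q.2.1 q.2.2) ∧
    (Continuous fun q : ℝ × ℝ × ℝ ↦ unitPhiVec q.2.2) ∧
    (Continuous fun q : ℝ × ℝ × ℝ ↦ dUnitPhiVec q.2.2) := by
  refine ⟨?_, ?_, ?_, ?_, ?_, ?_, ?_, ?_, ?_⟩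
  · simp only [horizonNull]; refine continuous_toLp_four ?_ ?_ ?_ ?_ <;> fun_prop
  · simp only [thetaVec]; refine continuous_toLp_four ?_ ?_ ?_ ?_ <;> fun_prop
  · simp only [dThetaVec]; refine continuous_toLp_four ?_ ?_ ?_ ?_ <;> fun_prop
  · simp only [phiHatVec]; refine continuous_toLp_four ?_ ?_ ?_ ?_ <;> fun_prop
  · simp only [dPhiHatVec]; refine continuous_toLp_four ?_ ?_ ?_ ?_ <;> fun_prop
  · simp only [dPhiHorizonNull]; refine continuous_toLp_four ?_ ?_ ?_ ?_ <;> fun_prop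
  · simp only [dThetaHorizonNull]; refine continuous_toLp_four ?_ ?_ ?_ ?_ <;> fun_prop
  · simp only [unitPhiVec]; refine continuous_toLp_four ?_ ?_ ?_ ?_ <;> fun_prop
  · simp only [dUnitPhiVec]; refine continuous_toLp_four ?_ ?_ ?_ ?_ <;> fun_prop

/-- **Joint continuity of the clamped `φ`-flux derivative** for a smooth `Ψ`. [folklore] -/
theorem continuous_secondPhiFluxDeriv_clamp (hΨ : ContDiff ℝ ∞ Ψ) :
    Continuous fun q : ℝ × ℝ × ℝ ↦ secondPhiFluxDeriv M Ψ (max q.1 0) q.2.1 q.2.2 := by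
  have hP := continuous_horizonPoint_clamp M
  obtain ⟨hN, hΘ, hdΘ, hΦ', hdΦ, hdN, hdθN, hn, hdn⟩ := continuous_frames (M := M)
  have h1c : ContDiff ℝ ∞ (fderiv ℝ Ψ) := hΨ.fderiv_right (m := ∞) le_rfl
  have h2c : ContDiff ℝ ∞ (fderiv ℝ (fderiv ℝ Ψ)) := h1c.fderiv_right (m := ∞) le_rfl
  have hLq : Continuous fun q : ℝ × ℝ × ℝ ↦ fderiv ℝ Ψ (horizonPoint M (max q.1 0) q.2.1 q.2.2) :=
    (hΨ.continuous_fderiv (WithTop.coe_ne_zero.mpr ENat.top_ne_zero)).comp hP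
  have hBq : Continuous fun q : ℝ × ℝ × ℝ ↦ fderiv ℝ (fderiv ℝ Ψ) (horizonPoint M (max q.1 0) q.2.1 q.2.2) :=
    (h1c.continuous_fderiv (WithTop.coe_ne_zero.mpr ENat.top_ne_zero)).comp hP
  have hCq : Continuous fun q : ℝ × ℝ × ℝ ↦
      fderiv ℝ (fderiv ℝ (fderiv ℝ Ψ)) (horizonPoint M (max q.1 0) q.2.1 q.2.2) :=
    (h2c.continuous_fderiv (WithTop.coe_ne_zero.mpr ENat.top_ne_zero)).comp hP
  have hΦ : Continuous fun q : ℝ × ℝ × ℝ ↦ Real.sin q.2.1 • phiHatVec M q.2.2 :=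
    (Real.continuous_sin.comp (continuous_fst.comp continuous_snd)).smul hΦ'
  simp only [secondPhiFluxDeriv]
  exact (((by fun_prop : Continuous fun q : ℝ × ℝ × ℝ ↦ 2 * M * Real.sin q.2.1).mul
    (((((hCq.clm_apply hΦ).clm_apply continuous_const).clm_apply hN).add
      ((hBq.clm_apply continuous_const).clm_apply hdN)).add
      (((((hCq.clm_apply hΦ).clm_apply hN).clm_apply hN).add ((hBq.clm_apply hdN).clm_apply hN)).add
        ((hBq.clm_apply hN).clm_apply hdN)))).add
    (((((hCq.clm_apply hΦ).clm_apply hΦ').clm_apply hN).add ((hBq.clm_apply hdΦ).clm_apply hN)).add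
      ((hBq.clm_apply hΦ').clm_apply hdN))).add
    (((hBq.clm_apply hΦ).clm_apply hn).add (hLq.clm_apply hdn))

/-- **Joint continuity of the clamped `θ`-flux derivative.** [folklore] -/
theorem continuous_secondThetaFluxDeriv_clamp (hΨ : ContDiff ℝ ∞ Ψ) :
    Continuous fun q : ℝ × ℝ × ℝ ↦ secondThetaFluxDeriv M Ψ (max q.1 0) q.2.1 q.2.2 := by
  have hP := continuous_horizonPoint_clamp M
  obtain ⟨hN, hΘ, hdΘ, hΦ', hdΦ, hdN, hdθN, hn, hdn⟩ := continuous_frames (M := M)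
  have h1c : ContDiff ℝ ∞ (fderiv ℝ Ψ) := hΨ.fderiv_right (m := ∞) le_rfl
  have h2c : ContDiff ℝ ∞ (fderiv ℝ (fderiv ℝ Ψ)) := h1c.fderiv_right (m := ∞) le_rfl
  have hLq : Continuous fun q : ℝ × ℝ × ℝ ↦ fderiv ℝ Ψ (horizonPoint M (max q.1 0) q.2.1 q.2.2) :=
    (hΨ.continuous_fderiv (WithTop.coe_ne_zero.mpr ENat.top_ne_zero)).comp hP
  have hBq : Continuous fun q : ℝ × ℝ × ℝ ↦ fderiv ℝ (fderiv ℝ Ψ) (horizonPoint M (max q.1 0) q.2.1 q.2.2) :=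
    (h1c.continuous_fderiv (WithTop.coe_ne_zero.mpr ENat.top_ne_zero)).comp hP
  have hCq : Continuous fun q : ℝ × ℝ × ℝ ↦
      fderiv ℝ (fderiv ℝ (fderiv ℝ Ψ)) (horizonPoint M (max q.1 0) q.2.1 q.2.2) :=
    (h2c.continuous_fderiv (WithTop.coe_ne_zero.mpr ENat.top_ne_zero)).comp hP
  have hTY : Continuous fun q : ℝ × ℝ × ℝ ↦ -(horizonNull q.2.1 q.2.2 + E4.basisVector 0) :=
    (hN.add continuous_const).neg
  simp only [secondThetaFluxDeriv]
  exact ((by fun_prop : Continuous fun q : ℝ × ℝ × ℝ ↦ Real.cos q.2.1).mul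
    (((hBq.clm_apply hΘ).clm_apply hN).add (hLq.clm_apply hdθN))).add
    ((by fun_prop : Continuous fun q : ℝ × ℝ × ℝ ↦ Real.sin q.2.1).mul
      ((((((hCq.clm_apply hΘ).clm_apply hΘ).clm_apply hN).add ((hBq.clm_apply hdΘ).clm_apply hN)).add
        ((hBq.clm_apply hΘ).clm_apply hdθN)).add
        (((hBq.clm_apply hΘ).clm_apply hdθN).add (hLq.clm_apply hTY))))

/-- Joint continuity of the clamped source term `sin θ · YΨ(p)`. [folklore] -/
theorem continuous_source_clamp (hΨ : ContDiff ℝ ∞ Ψ) :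
    Continuous fun q : ℝ × ℝ × ℝ ↦ Real.sin q.2.1 *
      fderiv ℝ Ψ (horizonPoint M (max q.1 0) q.2.1 q.2.2) (horizonNull q.2.1 q.2.2) := by
  have hP := continuous_horizonPoint_clamp M
  obtain ⟨hN, -, -, -, -, -, -, -, -⟩ := continuous_frames (M := M)
  have hLq : Continuous fun q : ℝ × ℝ × ℝ ↦ fderiv ℝ Ψ (horizonPoint M (max q.1 0) q.2.1 q.2.2) :=
    (hΨ.continuous_fderiv (WithTop.coe_ne_zero.mpr ENat.top_ne_zero)).comp hP
  exact (by fun_prop : Continuous fun q : ℝ × ℝ × ℝ ↦ Real.sin q.2.1).mul (hLq.clm_apply hN)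

/-- **Joint continuity of the second-order density in `(σ, θ, φ)` (clamped).** [folklore] -/
theorem continuous_secondDensity_clamp (hΨ : ContDiff ℝ ∞ Ψ) :
    Continuous fun q : ℝ × ℝ × ℝ ↦ secondDensity M Ψ (max q.1 0) q.2.1 q.2.2 := by
  have hP := continuous_horizonPoint_clamp M
  obtain ⟨hN, -, -, -, -, -, -, -, -⟩ := continuous_frames (M := M)
  have h1c : ContDiff ℝ ∞ (fderiv ℝ Ψ) := hΨ.fderiv_right (m := ∞) le_rfl
  have hΨq : Continuous fun q : ℝ × ℝ × ℝ ↦ Ψ (horizonPoint M (max q.1 0) q.2.1 q.2.2) :=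
    hΨ.continuous.comp hP
  have hLq : Continuous fun q : ℝ × ℝ × ℝ ↦ fderiv ℝ Ψ (horizonPoint M (max q.1 0) q.2.1 q.2.2) :=
    (hΨ.continuous_fderiv (WithTop.coe_ne_zero.mpr ENat.top_ne_zero)).comp hP
  have hBq : Continuous fun q : ℝ × ℝ × ℝ ↦ fderiv ℝ (fderiv ℝ Ψ) (horizonPoint M (max q.1 0) q.2.1 q.2.2) :=
    (h1c.continuous_fderiv (WithTop.coe_ne_zero.mpr ENat.top_ne_zero)).comp hP
  simp only [secondDensity]
  exact (((((by fun_prop : Continuous fun q : ℝ × ℝ × ℝ ↦ M ^ 2 * Real.sin q.2.1 ^ 2).mul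
    ((hBq.clm_apply continuous_const).clm_apply hN)).add
    (continuous_const.mul ((hBq.clm_apply hN).clm_apply hN))).add
    (continuous_const.mul (hLq.clm_apply hN))).add (continuous_const.mul hΨq)).mul (by fun_prop)

/-- Continuity of the second-order density on each sphere `S_σ`. [folklore] -/
theorem continuous_secondDensity_angles (hΨ : ContDiff ℝ ∞ Ψ) {σ : ℝ} (hσ : 0 ≤ σ) :
    Continuous fun q : ℝ × ℝ ↦ secondDensity M Ψ σ q.1 q.2 := by
  have h := (continuous_secondDensity_clamp (M := M) hΨ).comp
    (Continuous.prodMk continuous_const continuous_id : Continuous fun q : ℝ × ℝ ↦ ((σ, q) : ℝ × ℝ × ℝ))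
  exact h.congr fun q ↦ by simp only [Function.comp_apply, max_eq_left hσ]

end Continuity2

/-! ### Sphere lemmas: conservation with a source term, and integration of tangential divergences -/

/-- **The sphere lemma with a source.** If for `σ ≥ 0` the `σ`-derivative of a density `D(σ, θ, φ)` is
`c · (∂_φ E + ∂_θ T) + S` with `E` `2π`-periodic in `φ`, `T` vanishing at the poles and everything
jointly continuous, then for `0 ≤ a ≤ b`
`∫∫ D(b) = ∫∫ D(a) + ∫_a^b ∫∫ S(σ) dσ` (sphere integrals `∫₀^{2π} ∫₀^π · dθ dφ`).
[cite: Aretakis2015, Thm. 2 (proof: integration along the null geodesics of 𝓗⁺)] -/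
theorem sphereIntegral_eq_add_source {D E T dE dT S : ℝ → ℝ → ℝ → ℝ} {c a b : ℝ} (ha : 0 ≤ a)
    (hab : a ≤ b)
    (hD : ∀ σ θ φ, 0 ≤ σ → HasDerivAt (fun σ' ↦ D σ' θ φ) (c * (dE σ θ φ + dT σ θ φ) + S σ θ φ) σ)
    (hE : ∀ σ θ φ, 0 ≤ σ → HasDerivAt (fun φ' ↦ E σ θ φ') (dE σ θ φ) φ)
    (hEper : ∀ σ θ, 0 ≤ σ → E σ θ (2 * Real.pi) = E σ θ 0)
    (hT : ∀ σ θ φ, 0 ≤ σ → HasDerivAt (fun θ' ↦ T σ θ' φ) (dT σ θ φ) θ)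
    (hT0 : ∀ σ φ, T σ 0 φ = 0) (hTπ : ∀ σ φ, T σ Real.pi φ = 0)
    (hdE : Continuous fun q : ℝ × ℝ × ℝ ↦ dE (max q.1 0) q.2.1 q.2.2)
    (hdT : Continuous fun q : ℝ × ℝ × ℝ ↦ dT (max q.1 0) q.2.1 q.2.2)
    (hS : Continuous fun q : ℝ × ℝ × ℝ ↦ S (max q.1 0) q.2.1 q.2.2)
    (hDc : Continuous fun q : ℝ × ℝ × ℝ ↦ D (max q.1 0) q.2.1 q.2.2) :
    ∫ φ in (0 : ℝ)..2 * Real.pi, ∫ θ in (0 : ℝ)..Real.pi, D b θ φ =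
      (∫ φ in (0 : ℝ)..2 * Real.pi, ∫ θ in (0 : ℝ)..Real.pi, D a θ φ) +
        ∫ σ in a..b, ∫ φ in (0 : ℝ)..2 * Real.pi, ∫ θ in (0 : ℝ)..Real.pi, S σ θ φ := by
  have hπ : (0 : ℝ) ≤ Real.pi := Real.pi_pos.le
  have h2π : (0 : ℝ) ≤ 2 * Real.pi := by positivity
  have hb : 0 ≤ b := ha.trans hab
  -- clamped, globally continuous integrands
  set F : ℝ → ℝ → ℝ → ℝ := fun σ θ φ ↦ dE (max σ 0) θ φ with hF
  set G : ℝ → ℝ → ℝ → ℝ := fun σ θ φ ↦ dT (max σ 0) θ φ with hG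
  set R : ℝ → ℝ → ℝ → ℝ := fun σ θ φ ↦ S (max σ 0) θ φ with hR
  have hFc : Continuous fun q : ℝ × ℝ × ℝ ↦ F q.1 q.2.1 q.2.2 := hdE
  have hGc : Continuous fun q : ℝ × ℝ × ℝ ↦ G q.1 q.2.1 q.2.2 := hdT
  have hRc : Continuous fun q : ℝ × ℝ × ℝ ↦ R q.1 q.2.1 q.2.2 := hS
  -- continuity in various groupings
  have grp3 : ∀ {K : ℝ → ℝ → ℝ → ℝ}, (Continuous fun q : ℝ × ℝ × ℝ ↦ K q.1 q.2.1 q.2.2) →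
      (∀ φ, Continuous (Function.uncurry fun σ θ ↦ K σ θ φ)) ∧
      (∀ φ, Continuous (Function.uncurry fun θ σ ↦ K σ θ φ)) ∧
      (∀ θ, Continuous (Function.uncurry fun φ σ ↦ K σ θ φ)) ∧
      (∀ θ φ, Continuous fun σ ↦ K σ θ φ) ∧ (∀ σ φ, Continuous fun θ ↦ K σ θ φ) ∧
      (∀ σ θ, Continuous fun φ ↦ K σ θ φ) ∧
      (Continuous (Function.uncurry fun (q : ℝ × ℝ) σ ↦ K σ q.2 q.1)) ∧
      (∀ σ, Continuous (Function.uncurry fun φ θ ↦ K σ θ φ)) := by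
    intro K hK
    refine ⟨fun φ ↦ ?_, fun φ ↦ ?_, fun θ ↦ ?_, fun θ φ ↦ ?_, fun σ φ ↦ ?_, fun σ θ ↦ ?_, ?_, fun σ ↦ ?_⟩
    · exact hK.comp (Continuous.prodMk continuous_fst (Continuous.prodMk continuous_snd continuous_const))
    · exact hK.comp (Continuous.prodMk continuous_snd (Continuous.prodMk continuous_fst continuous_const))
    · exact hK.comp (Continuous.prodMk continuous_snd (Continuous.prodMk continuous_const continuous_fst))
    · exact hK.comp (Continuous.prodMk continuous_id (Continuous.prodMk continuous_const continuous_const))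
    · exact hK.comp (Continuous.prodMk continuous_const (Continuous.prodMk continuous_id continuous_const))
    · exact hK.comp (Continuous.prodMk continuous_const (Continuous.prodMk continuous_const continuous_id))
    · exact hK.comp (Continuous.prodMk continuous_snd (Continuous.prodMk (continuous_snd.comp continuous_fst)
        (continuous_fst.comp continuous_fst)))
    · exact hK.comp (Continuous.prodMk continuous_const (Continuous.prodMk continuous_snd continuous_fst))
  obtain ⟨hF_σθ, -, hF_φσ, hF_σ, -, hF_φ, hF_q, -⟩ := grp3 hFc
  obtain ⟨-, hG_θσ, -, hG_σ, hG_θ, -, hG_q, -⟩ := grp3 hGc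
  obtain ⟨-, hR_θσ, hR_φσ, hR_σ, hR_θ, hR_φ, hR_q, hR_φθ⟩ := grp3 hRc
  obtain ⟨-, -, -, -, hD_θ, -, -, hD_φθ⟩ := grp3 (K := fun σ θ φ ↦ D (max σ 0) θ φ) hDc
  -- parametric integrals in `σ` are continuous in the remaining variables
  have hIF : Continuous (Function.uncurry fun φ θ ↦ ∫ σ in a..b, F σ θ φ) :=
    intervalIntegral.continuous_parametric_intervalIntegral_of_continuous' hF_q a b
  have hIG : Continuous (Function.uncurry fun φ θ ↦ ∫ σ in a..b, G σ θ φ) :=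
    intervalIntegral.continuous_parametric_intervalIntegral_of_continuous' hG_q a b
  have hIR : Continuous (Function.uncurry fun φ θ ↦ ∫ σ in a..b, R σ θ φ) :=
    intervalIntegral.continuous_parametric_intervalIntegral_of_continuous' hR_q a b
  have hIF_θ : ∀ φ, Continuous fun θ ↦ ∫ σ in a..b, F σ θ φ := fun φ ↦
    hIF.comp (Continuous.prodMk continuous_const continuous_id)
  have hIG_θ : ∀ φ, Continuous fun θ ↦ ∫ σ in a..b, G σ θ φ := fun φ ↦
    hIG.comp (Continuous.prodMk continuous_const continuous_id)
  have hIR_θ : ∀ φ, Continuous fun θ ↦ ∫ σ in a..b, R σ θ φ := fun φ ↦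
    hIR.comp (Continuous.prodMk continuous_const continuous_id)
  -- Step A: fundamental theorem of calculus in `σ` on `[a, b]`
  have hFTC : ∀ θ φ, D b θ φ - D a θ φ =
      c * (∫ σ in a..b, F σ θ φ) + c * (∫ σ in a..b, G σ θ φ) + ∫ σ in a..b, R σ θ φ := by
    intro θ φ
    have hderiv : ∀ σ ∈ uIcc a b, HasDerivAt (fun σ' ↦ D σ' θ φ)
        (c * (F σ θ φ + G σ θ φ) + R σ θ φ) σ := by
      intro σ hσ
      rw [uIcc_of_le hab] at hσ
      have hσ0 : 0 ≤ σ := ha.trans hσ.1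
      have h := hD σ θ φ hσ0
      simp only [hF, hG, hR, max_eq_left hσ0]
      exact h
    have hint1 : IntervalIntegrable (fun σ ↦ c * (F σ θ φ + G σ θ φ)) volume a b :=
      (continuous_const.mul ((hF_σ θ φ).add (hG_σ θ φ))).intervalIntegrable a b
    have hintR : IntervalIntegrable (fun σ ↦ R σ θ φ) volume a b := (hR_σ θ φ).intervalIntegrable a b
    have hint : IntervalIntegrable (fun σ ↦ c * (F σ θ φ + G σ θ φ) + R σ θ φ) volume a b := hint1.add hintR
    have hintF : IntervalIntegrable (fun σ ↦ F σ θ φ) volume a b := (hF_σ θ φ).intervalIntegrable a b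
    have hintG : IntervalIntegrable (fun σ ↦ G σ θ φ) volume a b := (hG_σ θ φ).intervalIntegrable a b
    rw [← intervalIntegral.integral_eq_sub_of_hasDerivAt hderiv hint, intervalIntegral.integral_add hint1 hintR,
      intervalIntegral.integral_const_mul, intervalIntegral.integral_add hintF hintG]
    ring
  -- Step C: the polar total derivative integrates to zero
  have hGzero : ∀ φ, ∫ θ in (0 : ℝ)..Real.pi, ∫ σ in a..b, G σ θ φ = 0 := by
    intro φ
    rw [intervalIntegral_swap_of_continuous (hG_θσ φ) hπ hab]
    refine intervalIntegral.integral_zero_ae (Eventually.of_forall fun σ hσ ↦ ?_)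
    rw [uIoc_of_le hab] at hσ
    have hσ0 : 0 ≤ σ := ha.trans hσ.1.le
    have hderiv : ∀ θ ∈ uIcc (0 : ℝ) Real.pi, HasDerivAt (fun θ' ↦ T σ θ' φ) (G σ θ φ) θ := by
      intro θ _
      simp only [hG, max_eq_left hσ0]
      exact hT σ θ φ hσ0
    rw [intervalIntegral.integral_eq_sub_of_hasDerivAt hderiv ((hG_θ σ φ).intervalIntegrable _ _),
      hTπ, hT0, sub_zero]
  -- Step D: the azimuthal derivative integrates to zero
  have hFzero : ∫ φ in (0 : ℝ)..2 * Real.pi, ∫ θ in (0 : ℝ)..Real.pi, ∫ σ in a..b, F σ θ φ = 0 := by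
    rw [intervalIntegral_swap_of_continuous hIF h2π hπ]
    refine intervalIntegral.integral_zero_ae (Eventually.of_forall fun θ _ ↦ ?_)
    rw [intervalIntegral_swap_of_continuous (hF_φσ θ) h2π hab]
    refine intervalIntegral.integral_zero_ae (Eventually.of_forall fun σ hσ ↦ ?_)
    rw [uIoc_of_le hab] at hσ
    have hσ0 : 0 ≤ σ := ha.trans hσ.1.le
    have hderiv : ∀ φ ∈ uIcc (0 : ℝ) (2 * Real.pi), HasDerivAt (fun φ' ↦ E σ θ φ') (F σ θ φ) φ := by
      intro φ _
      simp only [hF, max_eq_left hσ0]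
      exact hE σ θ φ hσ0
    rw [intervalIntegral.integral_eq_sub_of_hasDerivAt hderiv ((hF_φ σ θ).intervalIntegrable _ _),
      hEper σ θ hσ0, sub_self]
  -- Step E: the source term, with the order of integration exchanged
  have hRswap : ∫ φ in (0 : ℝ)..2 * Real.pi, ∫ θ in (0 : ℝ)..Real.pi, ∫ σ in a..b, R σ θ φ =
      ∫ σ in a..b, ∫ φ in (0 : ℝ)..2 * Real.pi, ∫ θ in (0 : ℝ)..Real.pi, S σ θ φ := by
    have h1 : ∀ φ, ∫ θ in (0 : ℝ)..Real.pi, ∫ σ in a..b, R σ θ φ = ∫ σ in a..b, ∫ θ in (0 : ℝ)..Real.pi, R σ θ φ :=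
      fun φ ↦ intervalIntegral_swap_of_continuous (hR_θσ φ) hπ hab
    simp only [h1]
    have h2 : Continuous (Function.uncurry fun φ σ ↦ ∫ θ in (0 : ℝ)..Real.pi, R σ θ φ) := by
      have h : Continuous (Function.uncurry fun (q : ℝ × ℝ) θ ↦ R q.2 θ q.1) :=
        hRc.comp (Continuous.prodMk (continuous_snd.comp continuous_fst)
          (Continuous.prodMk continuous_snd (continuous_fst.comp continuous_fst)))
      exact intervalIntegral.continuous_parametric_intervalIntegral_of_continuous' h 0 Real.pi
    rw [intervalIntegral_swap_of_continuous h2 h2π hab]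
    refine intervalIntegral.integral_congr fun σ hσ ↦ ?_
    rw [uIcc_of_le hab] at hσ
    have hσ0 : 0 ≤ σ := ha.trans hσ.1
    simp only [hR, max_eq_left hσ0]
  -- Step B: assemble
  have hDb : ∀ φ, IntervalIntegrable (fun θ ↦ D b θ φ) volume 0 Real.pi := fun φ ↦ by
    have h := hD_θ b φ
    simp only [max_eq_left hb] at h
    exact h.intervalIntegrable _ _
  have hDa : ∀ φ, IntervalIntegrable (fun θ ↦ D a θ φ) volume 0 Real.pi := fun φ ↦ by
    have h := hD_θ a φ
    simp only [max_eq_left ha] at h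
    exact h.intervalIntegrable _ _
  have hIDσ : ∀ {s : ℝ}, 0 ≤ s → IntervalIntegrable (fun φ ↦ ∫ θ in (0 : ℝ)..Real.pi, D s θ φ) volume 0 (2 * Real.pi) := by
    intro s hs
    have h := hD_φθ s
    simp only [max_eq_left hs] at h
    exact (intervalIntegral.continuous_parametric_intervalIntegral_of_continuous' h 0 Real.pi).intervalIntegrable _ _
  have hIRφ : IntervalIntegrable (fun φ ↦ ∫ θ in (0 : ℝ)..Real.pi, ∫ σ in a..b, R σ θ φ) volume 0 (2 * Real.pi) :=
    (intervalIntegral.continuous_parametric_intervalIntegral_of_continuous' hIR 0 Real.pi).intervalIntegrable _ _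
  rw [← hRswap, ← intervalIntegral.integral_add (hIDσ ha) hIRφ, ← sub_eq_zero,
    ← intervalIntegral.integral_sub (hIDσ hb) ((hIDσ ha).add hIRφ)]
  have hinner : ∀ φ, (∫ θ in (0 : ℝ)..Real.pi, D b θ φ) -
      ((∫ θ in (0 : ℝ)..Real.pi, D a θ φ) + ∫ θ in (0 : ℝ)..Real.pi, ∫ σ in a..b, R σ θ φ) =
      c * ∫ θ in (0 : ℝ)..Real.pi, ∫ σ in a..b, F σ θ φ := by
    intro φ
    have hIRθ' : IntervalIntegrable (fun θ ↦ ∫ σ in a..b, R σ θ φ) volume 0 Real.pi :=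
      (hIR_θ φ).intervalIntegrable _ _
    rw [← intervalIntegral.integral_add (hDa φ) hIRθ', ← intervalIntegral.integral_sub (hDb φ) ((hDa φ).add hIRθ')]
    have hpt : ∀ θ, D b θ φ - (D a θ φ + ∫ σ in a..b, R σ θ φ) =
        c * (∫ σ in a..b, F σ θ φ) + c * ∫ σ in a..b, G σ θ φ := by
      intro θ
      have h := hFTC θ φ
      linarith
    simp only [hpt]
    have i1 : IntervalIntegrable (fun θ ↦ c * ∫ σ in a..b, F σ θ φ) volume 0 Real.pi :=
      (continuous_const.mul (hIF_θ φ)).intervalIntegrable _ _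
    have i2 : IntervalIntegrable (fun θ ↦ c * ∫ σ in a..b, G σ θ φ) volume 0 Real.pi :=
      (continuous_const.mul (hIG_θ φ)).intervalIntegrable _ _
    rw [intervalIntegral.integral_add i1 i2, intervalIntegral.integral_const_mul,
      intervalIntegral.integral_const_mul, hGzero φ, mul_zero, add_zero]
  simp only [hinner, intervalIntegral.integral_const_mul, hFzero, mul_zero]

/-- **Integration of tangential total derivatives over the sphere (static version).** If
`f = c · (∂_φ E + ∂_θ T) + g` on the sphere with `E` `2π`-periodic in `φ`, `T` vanishing at the poles
and the pieces continuous, then `∫∫ f = ∫∫ g`. [folklore] -/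
theorem sphereIntegral_eq_of_fluxes {f g E T dE dT : ℝ → ℝ → ℝ} {c : ℝ}
    (hf : ∀ θ φ, f θ φ = c * (dE θ φ + dT θ φ) + g θ φ)
    (hE : ∀ θ φ, HasDerivAt (fun φ' ↦ E θ φ') (dE θ φ) φ) (hEper : ∀ θ, E θ (2 * Real.pi) = E θ 0)
    (hT : ∀ θ φ, HasDerivAt (fun θ' ↦ T θ' φ) (dT θ φ) θ)
    (hT0 : ∀ φ, T 0 φ = 0) (hTπ : ∀ φ, T Real.pi φ = 0)
    (hdE : Continuous (Function.uncurry dE)) (hdT : Continuous (Function.uncurry dT))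
    (hg : Continuous (Function.uncurry g)) :
    ∫ φ in (0 : ℝ)..2 * Real.pi, ∫ θ in (0 : ℝ)..Real.pi, f θ φ =
      ∫ φ in (0 : ℝ)..2 * Real.pi, ∫ θ in (0 : ℝ)..Real.pi, g θ φ := by
  have hπ : (0 : ℝ) ≤ Real.pi := Real.pi_pos.le
  have h2π : (0 : ℝ) ≤ 2 * Real.pi := by positivity
  have hdE_θ : ∀ φ, Continuous fun θ ↦ dE θ φ := fun φ ↦ hdE.comp (Continuous.prodMk continuous_id continuous_const)
  have hdE_φ : ∀ θ, Continuous fun φ ↦ dE θ φ := fun θ ↦ hdE.comp (Continuous.prodMk continuous_const continuous_id)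
  have hdT_θ : ∀ φ, Continuous fun θ ↦ dT θ φ := fun φ ↦ hdT.comp (Continuous.prodMk continuous_id continuous_const)
  have hg_θ : ∀ φ, Continuous fun θ ↦ g θ φ := fun φ ↦ hg.comp (Continuous.prodMk continuous_id continuous_const)
  -- inner integrals
  have hinner : ∀ φ, ∫ θ in (0 : ℝ)..Real.pi, f θ φ =
      c * (∫ θ in (0 : ℝ)..Real.pi, dE θ φ) + ∫ θ in (0 : ℝ)..Real.pi, g θ φ := by
    intro φ
    simp only [hf]
    have i1 : IntervalIntegrable (fun θ ↦ c * (dE θ φ + dT θ φ)) volume 0 Real.pi :=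
      (continuous_const.mul ((hdE_θ φ).add (hdT_θ φ))).intervalIntegrable _ _
    have i2 : IntervalIntegrable (fun θ ↦ g θ φ) volume 0 Real.pi := (hg_θ φ).intervalIntegrable _ _
    have i3 : IntervalIntegrable (fun θ ↦ dE θ φ) volume 0 Real.pi := (hdE_θ φ).intervalIntegrable _ _
    have i4 : IntervalIntegrable (fun θ ↦ dT θ φ) volume 0 Real.pi := (hdT_θ φ).intervalIntegrable _ _
    rw [intervalIntegral.integral_add i1 i2, intervalIntegral.integral_const_mul,
      intervalIntegral.integral_add i3 i4]
    have hTz : ∫ θ in (0 : ℝ)..Real.pi, dT θ φ = 0 := by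
      rw [intervalIntegral.integral_eq_sub_of_hasDerivAt (fun θ _ ↦ hT θ φ) ((hdT_θ φ).intervalIntegrable _ _),
        hTπ, hT0, sub_zero]
    rw [hTz, add_zero]
  simp only [hinner]
  have hIE : Continuous fun φ ↦ ∫ θ in (0 : ℝ)..Real.pi, dE θ φ := by
    have h : Continuous (Function.uncurry fun φ θ ↦ dE θ φ) := hdE.comp (Continuous.prodMk continuous_snd continuous_fst)
    exact intervalIntegral.continuous_parametric_intervalIntegral_of_continuous' h 0 Real.pi
  have hIg : Continuous fun φ ↦ ∫ θ in (0 : ℝ)..Real.pi, g θ φ := by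
    have h : Continuous (Function.uncurry fun φ θ ↦ g θ φ) := hg.comp (Continuous.prodMk continuous_snd continuous_fst)
    exact intervalIntegral.continuous_parametric_intervalIntegral_of_continuous' h 0 Real.pi
  have iE : IntervalIntegrable (fun φ ↦ c * ∫ θ in (0 : ℝ)..Real.pi, dE θ φ) volume 0 (2 * Real.pi) :=
    (continuous_const.mul hIE).intervalIntegrable _ _
  have ig : IntervalIntegrable (fun φ ↦ ∫ θ in (0 : ℝ)..Real.pi, g θ φ) volume 0 (2 * Real.pi) :=
    hIg.intervalIntegrable _ _
  rw [intervalIntegral.integral_add iE ig, intervalIntegral.integral_const_mul]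
  have hEz : ∫ φ in (0 : ℝ)..2 * Real.pi, ∫ θ in (0 : ℝ)..Real.pi, dE θ φ = 0 := by
    have hc : Continuous (Function.uncurry fun φ θ ↦ dE θ φ) := hdE.comp (Continuous.prodMk continuous_snd continuous_fst)
    rw [intervalIntegral_swap_of_continuous hc h2π hπ]
    refine intervalIntegral.integral_zero_ae (Eventually.of_forall fun θ _ ↦ ?_)
    rw [intervalIntegral.integral_eq_sub_of_hasDerivAt (fun φ _ ↦ hE θ φ) ((hdE_φ θ).intervalIntegrable _ _),
      hEper θ, sub_self]
  rw [hEz, mul_zero, zero_add]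

end Literature.Barriers.FinalStateConjecture.Kerr

end
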